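import Literature.NumberTheory.Rogawski1990.UnitStableOrbitalIntegralHSideLevelValueOfIsRoot  -- ★-to-be FILE A (this seat): any-Haar stub-frame level values
import Literature.NumberTheory.Automorphic.ResiduallyTrivialFixedCosetCount                    -- ★ A-p12 ROW-0: `rank_redMat_sub_one_eq_zero_iff_forall_valuation_le`, `rank_eq_zero_iff_eq_zero` (+ ★ p845945 `redMat_sub_one_pow_eq_zero_of_deep`, `rank_lt_of_isNilpotent`, conj invariance)
import Literature.NumberTheory.Rogawski1990.LocalTransferGlueCM                                -- ★ `localStableOrbitalIntegralH_add_of_isLocSmooth`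
import Literature.NumberTheory.Rogawski1990.LocalStableOrbitalIntegralGlue                       -- ★ `stableOrbitalIntegralRel_congr_fun_of_eqOn`
import Literature.NumberTheory.Rogawski1990.FinExplicitTransferFactorLocallyConstant             -- ★ `continuous_fst_localMatrix`
import Literature.NumberTheory.Rogawski1990.AdelicStableClassSupportFinite                      -- ★ `charpoly_eq_of_isConj_units`
import HarnessLib

/-!
# T3′'s H-side values near the identity, TYPE (1): `Φ^st(γ_H, χ₀) = ν_H(K_H)·phiH q (N−1)` and `Φ^st(γ_H, χ₁) = ν_H(K_H)·(phiH q N − phiH q (N−1))`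
# for the residual Jordan-stratum class functions `χ_s = 1_{K_H}·[(red h_{W,w} − 1)² = 0 ∧ rank(red h_{W,w} − 1) = s]` of HEAD v4

Topic `NumberTheory/Rogawski1990`; namespace `Literature.NumberTheory.Automorphic.UnitaryGroup`.  THEOREMS ONLY (no definition, no instance, no notation, no named fact,
no `sorry`).  Cell `pub/hodgecm-mathlib`, crux H413, road «S3-tree», brick **T6 ∕ O8c «H-values near 1»** in the TOKENS of T3′ HEAD v4 (`depthZeroKappaTransfer_hyperspecial_typeOne`,
holder F0P3b-p01 (g11); socket ★ p845914: «the H-side `a₀Φ^st(χ₀) + a₁Φ^st(χ₁)` is this with O8c `Φ^st(χ₀) = ν_H(K_H)W(N−1)`, `Φ^st(χ₁) = ν_H(K_H)w_N`»); END∕T6 holder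
F0P3a-p03 (g15).  HC_CM is proved only modulo the cell's 2 remaining named inputs (hLiu418, h413) until rung 0 closes; this file is unconditional.

THE MATHEMATICS.  `H_v = U(Φ₂)(L⁺_v) × U(Φ₁)(L⁺_v)` at a non-split unramified `v` (`w ∣ v`), `K_H = K₂ × K₁` hyperspecial, `γ_H = (g, u)` `G`-regular elliptic with split
eigen-data `α ≠ γ` (the roots of `χ_{g,w}`), `N = ord_w(α − γ)`, DEEP: `α ≡ γ ≡ 1 (mod 𝔪_w)`.  For `h ∈ K_H` write `h̄_W = red(h_{2,w}) ∈ GL₂(𝔽_w)`.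
(1) `[(h̄_W − 1)² = 0 ∧ rank(h̄_W − 1) = 0] ⟺ h̄_W = 1 ⟺ h_{2,w} ≡ 1 (mod ϖ_w)` (★ A-p12 ROW-0 `rank_redMat_sub_one_eq_zero_iff_forall_valuation_le`), so `χ₀` IS the level-`ϖ_w`
class function of ★ FILE A and `Φ^st(γ_H, χ₀) = ν_H(K_H)·phiH q (N − 1)` (law C1 at `i = 1`).  (2) Every `K_H`-point of the STABLE orbit of a deep `γ_H` is residually
unipotent: its `w`-component has characteristic polynomial `(X − α)(X − γ) ≡ (X − 1)² (mod 𝔪_w)`, so `(h̄_W − 1)² = 0` (★ A-p12 `redMat_sub_one_pow_eq_zero_of_deep`,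
Cayley–Hamilton); a `2 × 2` nilpotent has rank `0` or `1` (★ `rank_lt_of_isNilpotent`), hence `χ₀ + χ₁ = 1_{K_H}` ON THE STABLE ORBIT, and `Φ^st` only sees the orbit
(★ `stableOrbitalIntegralRel_congr_fun_of_eqOn`).  (3) `χ₀, χ₁ ∈ C_c^∞(H_v)` (the reduction `h ↦ h̄_W` is locally constant on the compact open `K_H`), so by additivity
(★ `localStableOrbitalIntegralH_add_of_isLocSmooth`) `Φ^st(χ₁) = Φ^st(1_{K_H}) − Φ^st(χ₀) = ν_H(K_H)·(phiH q N − phiH q (N−1))` (`= ν_H(K_H)·q^{N−1}(q+1)`, the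
vertices at exact distance `N`, ★ `phiH_sub_phiH_pred`).  Measures enter only through `ν_H(K_H)` (architect A-79).

* §1 generic: `valuation_coeff_mul_sub_sq_lt_one` (deep quadratic), `red_eq_red_of_valuation_sub_lt_one`, `rank_eq_zero_or_eq_one_of_sq_eq_zero`,
  `sq_eq_zero_and_rank_eq_zero_iff_forall_valuation_le` (the ROW-0 bridge in HEAD v4's conjunction shape).
* §2 the place `w`: `localNonsplitEquiv_fst_mem_glInt`, `map_fst_conj_eq`, `eventually_redMat_eq_of_mem`, **`isLocSmooth_indicator_ite_redMat`** (`χ_s ∈ C_c^∞`, any `s`),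
  `indicator_ite_redMat_conj` (`K_H`-conjugation invariance), `indicator_ite_redMat_zero_add_one` (`χ₀ + χ₁ = 1_{K_H}` at residually unipotent points),
  **`sq_redMat_sub_one_eq_zero_of_isLocalStablyConjH`** (deep ⇒ residually unipotent on the stable orbit).
* §3 HEADS **`stableOrbitalIntegralRel_chiZero_eq_mul_phiH_of_isRoot`**, **`stableOrbitalIntegralRel_chiOne_eq_mul_phiH_sub_of_isRoot`** — binders: ★ StubFrame's
  `hv νH mH hmH γH hreg hell α γ hα hγ hαγ N hN` + deepness `hα1 : Valued.v (α − 1) < 1`, `hγ1 : Valued.v (γ − 1) < 1` + ONE decidability binder `χdec`∕`χdec₀ χdec₁` for the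
  `if` of HEAD v4's text (any instance: pass `_`, unification picks the consumer's).

## References
* [Rogawski1990] J. D. Rogawski, *Automorphic Representations of Unitary Groups in Three Variables* (1990), §4.9 Prop. 4.9.1 (b) p. 55, Lemma 4.9.3 p. 56; §4.3 (4.3.1) p. 43.
* [Flicker1998UnitaryFL] Y. Z. Flicker, *Elementary proof of the fundamental lemma for a unitary group*, Canad. J. Math. 50 (1998), §6 p. 95.
* [Kottwitz1986] R. E. Kottwitz, *Base change for unit elements of Hecke algebras*, Compositio Math. 60 (1986), §3.
* [Serre1979] J.-P. Serre, *Local Fields* (1979), Ch. I §1, Ch. II §1.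
-/

set_option autoImplicit false

noncomputable section

open MeasureTheory Measure Set Filter Topology NumberField IsDedekindDomain Matrix Polynomial ValuativeRel
open scoped ENNReal NNReal ValuativeRel Matrix MatrixGroups

namespace Literature.NumberTheory.Automorphic.UnitaryGroup

open Literature.NumberTheory.Rogawski1990 Literature.NumberTheory.Automorphic Literature.NumberTheory.Automorphic.IntegralReduction

/-! ## §1 Generic algebra: deep quadratics, equal reductions, rank of a `2 × 2` nilpotent, the ROW-0 bridge in conjunction shape -/

section Generic

/-- **A deep split quadratic is residually `(X − 1)²`**: if `v(x − 1), v(y − 1) < 1` then every coefficient of `(X − x)(X − y) − (X − 1)²` has valuation `< 1`.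
[cite: Kottwitz1986, §3] [cite: Serre1979, Ch. I §1] -/
theorem valuation_coeff_mul_sub_sq_lt_one {K : Type*} [Field K] {Γ : Type*} [LinearOrderedCommGroupWithZero Γ] (vK : Valuation K Γ)
    {x y : K} (hx : vK (x - 1) < 1) (hy : vK (y - 1) < 1) (m : ℕ) :
    vK (((X - C x) * (X - C y) - (X - 1) ^ 2).coeff m) < 1 := by
  set a := x - 1 with ha
  set b := y - 1 with hb
  have hx' : x = 1 + a := by rw [ha]; ring
  have hy' : y = 1 + b := by rw [hb]; ring
  have key : (X - C x) * (X - C y) - (X - 1 : K[X]) ^ 2 = C (a * b + (a + b)) + C (-(a + b)) * X := by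
    rw [hx', hy']
    simp only [map_add, map_one, map_neg, map_mul]
    ring
  have hmul : vK (a * b) < 1 := by rw [map_mul]; exact mul_lt_one_of_nonneg_of_lt_one_left zero_le hx hy.le
  have hadd : vK (a + b) < 1 := lt_of_le_of_lt (vK.map_add _ _) (max_lt hx hy)
  have hc0 : vK (a * b + (a + b)) < 1 := lt_of_le_of_lt (vK.map_add _ _) (max_lt hmul hadd)
  have hc1 : vK (-(a + b)) < 1 := by rwa [Valuation.map_neg]
  rw [key]
  simp only [coeff_add, coeff_C, coeff_C_mul, coeff_X]
  rcases m with _ | _ | m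
  · simpa using hc0
  · simpa using hc1
  · simp

variable {F : Type*} [Field F] [ValuativeRel F]

/-- **Integral elements that are congruent mod `𝔪` have the same reduction**: `x, y ∈ 𝒪`, `v(x − y) < 1 ⇒ red x = red y`. [cite: Serre1979, Ch. I §1] -/
theorem red_eq_red_of_valuation_sub_lt_one {x y : F} (hx : x ∈ 𝒪[F]) (hy : y ∈ 𝒪[F]) (h : valuation F (x - y) < 1) : red x = red y := by
  rw [show x = ((⟨x, hx⟩ : 𝒪[F]) : F) from rfl, show y = ((⟨y, hy⟩ : 𝒪[F]) : F) from rfl, red_coe, red_coe, ← sub_eq_zero, ← map_sub,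
    IsLocalRing.residue_eq_zero_iff, IsLocalRing.mem_maximalIdeal, mem_nonunits_iff, Valuation.Integer.not_isUnit_iff_valuation_lt_one]
  exact h

/-- **A `2 × 2` matrix of square zero over a field has rank `0` or `1`** (★ `rank_lt_of_isNilpotent`). [cite: Kottwitz1986, §3] -/
theorem rank_eq_zero_or_eq_one_of_sq_eq_zero {𝕜 : Type*} [Field 𝕜] {A : Matrix (Fin 2) (Fin 2) 𝕜} (hA : A ^ 2 = 0) : A.rank = 0 ∨ A.rank = 1 := by
  have h := rank_lt_of_isNilpotent ⟨2, hA⟩ (by norm_num : 0 < 2)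
  omega

/-- **THE ROW-0 BRIDGE IN HEAD v4's SHAPE**: for `k ∈ GL₂(𝒪)` and a uniformizing element `ϖ`, `[(red k − 1)² = 0 ∧ rank(red k − 1) = 0] ⟺ k ≡ 1 (mod ϖ)` entrywise
(★ A-p12 `rank_redMat_sub_one_eq_zero_iff_forall_valuation_le`; the nilpotency conjunct is implied by `rank = 0`). [cite: Kottwitz1986, §3] [cite: Serre1979, Ch. II §1] -/
theorem sq_eq_zero_and_rank_eq_zero_iff_forall_valuation_le {ϖ : F} (hϖ : IsUniformizingElement ϖ) {k : GL (Fin 2) F} (hk : k ∈ glInt 2 F) :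
    ((redMat (k : Matrix (Fin 2) (Fin 2) F) - 1) ^ 2 = 0 ∧ (redMat (k : Matrix (Fin 2) (Fin 2) F) - 1).rank = 0) ↔
      ∀ i j, valuation F (((k : Matrix (Fin 2) (Fin 2) F) - 1) i j) ≤ valuation F ϖ := by
  rw [← rank_redMat_sub_one_eq_zero_iff_forall_valuation_le hϖ hk]
  constructor
  · exact fun h => h.2
  · intro h
    refine ⟨?_, h⟩
    rw [(rank_eq_zero_iff_eq_zero _).1 h, zero_pow two_ne_zero]

end Generic

/-! ## §2 The place `w`: integrality on `K_H`, local constancy of the reduction, the class functions `χ_s`, residual unipotence on the stable orbit -/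

section Place

variable (L : Type) [Field L] [NumberField L] [IsCMField L] (v : HeightOneSpectrum (𝓞 ↥(maximalRealSubfield L)))
  (w : PlacesOver L v) (hw : IsCMField.complexConj L • w.1 = w.1)

include hw in
/-- For `h ∈ K_H`, the `w`-component `h_{2,w}` (the one-place model ★ `localNonsplitEquiv` of `h.1`) lies in `GL₂(𝒪_w)` (★ `mem_localIntegralLevel_iff_of_smul_eq`).
[cite: Rogawski1990, §4.9 p. 54] -/
theorem localNonsplitEquiv_fst_mem_glInt {h : ((cmDatum L 2 (Matrix.of fun i j : Fin 2 => if i.val + j.val + 1 = 2 then (1 : L) else 0)).Local v × (cmDatum L 1 (Matrix.of fun i j : Fin 1 => if i.val + j.val + 1 = 1 then (1 : L) else 0)).Local v)} (hh : h ∈ (((cmLocalIntegralLevel L 2 (Matrix.of fun i j : Fin 2 => if i.val + j.val + 1 = 2 then (1 : L) else 0) v).prod (cmLocalIntegralLevel L 1 (Matrix.of fun i j : Fin 1 => if i.val + j.val + 1 = 1 then (1 : L) else 0) v)) : Subgroup ((cmDatum L 2 (Matrix.of fun i j : Fin 2 => if i.val + j.val + 1 = 2 then (1 : L) else 0)).Local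 v × (cmDatum L 1 (Matrix.of fun i j : Fin 1 => if i.val + j.val + 1 = 1 then (1 : L) else 0)).Local v))) : ((localNonsplitEquiv (IsCMField.complexConj L) (Matrix.of fun i j : Fin 2 => if i.val + j.val + 1 = 2 then (1 : L) else 0) (IsCMField.complexConj_ne_one L) w hw (h).1 : ↥(unitaryGroupOfForm (galAdicCompletionMap (L := L) (IsCMField.complexConj L) hw) (placeForm (Matrix.of fun i j : Fin 2 => if i.val + j.val + 1 = 2 then (1 : L) else 0) w.1))) : GL (Fin 2) (w.1.adicCompletion L)) ∈ glInt 2 (w.1.adicCompletion L) :=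
  (mem_localIntegralLevel_iff_of_smul_eq (IsCMField.complexConj L) 2 (Matrix.of fun i j : Fin 2 => if i.val + j.val + 1 = 2 then (1 : L) else 0) (IsCMField.complexConj_ne_one L) w hw h.1).1 (Subgroup.mem_prod.1 hh).1

include hw in
/-- Entries of `h_{2,w}` are integral for `h ∈ K_H` (HEAD v4's spelling of the `w`-component, ★ `coe_localNonsplitEquiv_apply` = `rfl`). [cite: Rogawski1990, §4.9 p. 54] -/
theorem apply_mem_integer_of_mem {h : ((cmDatum L 2 (Matrix.of fun i j : Fin 2 => if i.val + j.val + 1 = 2 then (1 : L) else 0)).Local v × (cmDatum L 1 (Matrix.of fun i j : Fin 1 => if i.val + j.val + 1 = 1 then (1 : L) else 0)).Local v)} (hh : h ∈ (((cmLocalIntegralLevel L 2 (Matrix.of fun i j : Fin 2 => if i.val + j.val + 1 = 2 then (1 : L) else 0) v).prod (cmLocalIntegralLevel L 1 (Matrix.of fun i j : Fin 1 => if i.val + j.val + 1 = 1 then (1 : L) else 0) v)) : Subgroup ((cmDatum L 2 (Matrix.of fun i j : Fin 2 => if i.val + j.val + 1 = 2 then (1 : L) else 0)).Local v × (cmDatum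 L 1 (Matrix.of fun i j : Fin 1 => if i.val + j.val + 1 = 1 then (1 : L) else 0)).Local v))) (a b : Fin 2) : (((h).1.val : GL (Fin 2) (UnitaryGroup.LocalRing L v)).val.map (Pi.evalRingHom (fun w' : PlacesOver L v => w'.1.adicCompletion L) w)) a b ∈ 𝒪[(w.1.adicCompletion L)] :=
  ((mem_glInt_iff _).1 (localNonsplitEquiv_fst_mem_glInt L v w hw hh)).1 a b

include hw in
/-- **`(k x k⁻¹)_{2,w} = k′⁻¹ x_{2,w} k′` with `k′ = (k⁻¹)_{2,w}`** (the one-place model is a group isomorphism), in HEAD v4's matrix spelling on the left.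
[cite: Rogawski1990, §4.9 p. 54] -/
theorem map_fst_conj_eq (k x : ((cmDatum L 2 (Matrix.of fun i j : Fin 2 => if i.val + j.val + 1 = 2 then (1 : L) else 0)).Local v × (cmDatum L 1 (Matrix.of fun i j : Fin 1 => if i.val + j.val + 1 = 1 then (1 : L) else 0)).Local v)) :
    (((k * x * k⁻¹).1.val : GL (Fin 2) (UnitaryGroup.LocalRing L v)).val.map (Pi.evalRingHom (fun w' : PlacesOver L v => w'.1.adicCompletion L) w)) = (((((localNonsplitEquiv (IsCMField.complexConj L) (Matrix.of fun i j : Fin 2 => if i.val + j.val + 1 = 2 then (1 : L) else 0) (IsCMField.complexConj_ne_one L) w hw (k⁻¹).1 : ↥(unitaryGroupOfForm (galAdicCompletionMap (L := L) (IsCMField.complexConj L) hw) (placeForm (Matrix.of fun i j : Fin 2 => if i.val + j.val + 1 = 2 then (1 : L) else 0) w.1))) : GL (Fin 2) (w.1.adicCompletion L)))⁻¹ * ((localNonsplitEquiv (IsCMField.complexConj L) (Matrix.of fun i j : Fin 2 => if i.val + j.val + 1 = 2 then (1 : L) else 0) (IsCMField.complexConj_ne_one L) w hw (x).1 : ↥(unitaryGroupOfForm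 (galAdicCompletionMap (L := L) (IsCMField.complexConj L) hw) (placeForm (Matrix.of fun i j : Fin 2 => if i.val + j.val + 1 = 2 then (1 : L) else 0) w.1))) : GL (Fin 2) (w.1.adicCompletion L)) * ((localNonsplitEquiv (IsCMField.complexConj L) (Matrix.of fun i j : Fin 2 => if i.val + j.val + 1 = 2 then (1 : L) else 0) (IsCMField.complexConj_ne_one L) w hw (k⁻¹).1 : ↥(unitaryGroupOfForm (galAdicCompletionMap (L := L) (IsCMField.complexConj L) hw) (placeForm (Matrix.of fun i j : Fin 2 => if i.val + j.val + 1 = 2 then (1 : L) else 0) w.1))) : GL (Fin 2) (w.1.adicCompletion L)) : GL (Fin 2) (w.1.adicCompletion L)) : Matrix (Fin 2) (Fin 2) (w.1.adicCompletion L)) := by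
  have hmul : (((localNonsplitEquiv (IsCMField.complexConj L) (Matrix.of fun i j : Fin 2 => if i.val + j.val + 1 = 2 then (1 : L) else 0) (IsCMField.complexConj_ne_one L) w hw (k⁻¹).1 : ↥(unitaryGroupOfForm (galAdicCompletionMap (L := L) (IsCMField.complexConj L) hw) (placeForm (Matrix.of fun i j : Fin 2 => if i.val + j.val + 1 = 2 then (1 : L) else 0) w.1))) : GL (Fin 2) (w.1.adicCompletion L)))⁻¹ * ((localNonsplitEquiv (IsCMField.complexConj L) (Matrix.of fun i j : Fin 2 => if i.val + j.val + 1 = 2 then (1 : L) else 0) (IsCMField.complexConj_ne_one L) w hw (x).1 : ↥(unitaryGroupOfForm (galAdicCompletionMap (L := L) (IsCMField.complexConj L) hw) (placeForm (Matrix.of fun i j : Fin 2 => if i.val + j.val + 1 = 2 then (1 : L) else 0) w.1))) : GL (Fin 2) (w.1.adicCompletion L)) * ((localNonsplitEquiv (IsCMField.complexConj L) (Matrix.of fun i j : Fin 2 => if i.val + j.val + 1 = 2 then (1 : L) else 0) (IsCMField.complexConj_ne_one L) w hw (k⁻¹).1 : ↥(unitaryGroupOfForm (galAdicCompletionMap (L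 := L) (IsCMField.complexConj L) hw) (placeForm (Matrix.of fun i j : Fin 2 => if i.val + j.val + 1 = 2 then (1 : L) else 0) w.1))) : GL (Fin 2) (w.1.adicCompletion L)) = ((localNonsplitEquiv (IsCMField.complexConj L) (Matrix.of fun i j : Fin 2 => if i.val + j.val + 1 = 2 then (1 : L) else 0) (IsCMField.complexConj_ne_one L) w hw (k * x * k⁻¹).1 : ↥(unitaryGroupOfForm (galAdicCompletionMap (L := L) (IsCMField.complexConj L) hw) (placeForm (Matrix.of fun i j : Fin 2 => if i.val + j.val + 1 = 2 then (1 : L) else 0) w.1))) : GL (Fin 2) (w.1.adicCompletion L)) := by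
    rw [← Subgroup.coe_inv, ← Subgroup.coe_mul, ← Subgroup.coe_mul, ← map_inv, ← map_mul, ← map_mul]
    -- `(k⁻¹)₂⁻¹ x₂ (k⁻¹)₂ = (k x k⁻¹)₂` definitionally (structure eta on the unit `k₂`)
    rfl
  rw [hmul]
  exact (coe_localNonsplitEquiv_apply L (Matrix.of fun i j : Fin 2 => if i.val + j.val + 1 = 2 then (1 : L) else 0) v w hw (k * x * k⁻¹).1).symm

include hw in
/-- **THE REDUCTION `h ↦ red(h_{2,w})` IS LOCALLY CONSTANT ON `K_H`**: near `h₀ ∈ K_H`, every `h ∈ K_H` has `red(h_{2,w}) = red((h₀)_{2,w})` (the entries are continuous,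
★ `continuous_fst_localMatrix`, and the unit ball `{|z| < 1}` of `L_w` is open). [cite: Rogawski1990, §4.9 p. 54] [cite: Serre1979, Ch. II §1] -/
theorem eventually_redMat_eq_of_mem {h₀ : ((cmDatum L 2 (Matrix.of fun i j : Fin 2 => if i.val + j.val + 1 = 2 then (1 : L) else 0)).Local v × (cmDatum L 1 (Matrix.of fun i j : Fin 1 => if i.val + j.val + 1 = 1 then (1 : L) else 0)).Local v)} (hh₀ : h₀ ∈ (((cmLocalIntegralLevel L 2 (Matrix.of fun i j : Fin 2 => if i.val + j.val + 1 = 2 then (1 : L) else 0) v).prod (cmLocalIntegralLevel L 1 (Matrix.of fun i j : Fin 1 => if i.val + j.val + 1 = 1 then (1 : L) else 0) v)) : Subgroup ((cmDatum L 2 (Matrix.of fun i j : Fin 2 => if i.val + j.val + 1 = 2 then (1 : L) else 0)).Local v × (cmDatum L 1 (Matrix.of fun i j : Fin 1 => if i.val + j.val + 1 = 1 then (1 : L) else 0)).Local v))) :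
    ∀ᶠ h in 𝓝 h₀, h ∈ (((cmLocalIntegralLevel L 2 (Matrix.of fun i j : Fin 2 => if i.val + j.val + 1 = 2 then (1 : L) else 0) v).prod (cmLocalIntegralLevel L 1 (Matrix.of fun i j : Fin 1 => if i.val + j.val + 1 = 1 then (1 : L) else 0) v)) : Subgroup ((cmDatum L 2 (Matrix.of fun i j : Fin 2 => if i.val + j.val + 1 = 2 then (1 : L) else 0)).Local v × (cmDatum L 1 (Matrix.of fun i j : Fin 1 => if i.val + j.val + 1 = 1 then (1 : L) else 0)).Local v)) → redMat (((h).1.val : GL (Fin 2) (UnitaryGroup.LocalRing L v)).val.map (Pi.evalRingHom (fun w' : PlacesOver L v => w'.1.adicCompletion L) w)) = redMat (((h₀).1.val : GL (Fin 2) (UnitaryGroup.LocalRing L v)).val.map (Pi.evalRingHom (fun w' : PlacesOver L v => w'.1.adicCompletion L) w)) := by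
  have hcont : ∀ a b : Fin 2, Continuous fun h : ((cmDatum L 2 (Matrix.of fun i j : Fin 2 => if i.val + j.val + 1 = 2 then (1 : L) else 0)).Local v × (cmDatum L 1 (Matrix.of fun i j : Fin 1 => if i.val + j.val + 1 = 1 then (1 : L) else 0)).Local v) => (((h).1.val : GL (Fin 2) (UnitaryGroup.LocalRing L v)).val.map (Pi.evalRingHom (fun w' : PlacesOver L v => w'.1.adicCompletion L) w)) a b := fun a b =>
    (continuous_apply w).comp ((continuous_fst_localMatrix L v).matrix_elem a b)
  have hopen : IsOpen {z : (w.1.adicCompletion L) | Valued.v z < 1} := by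
    simpa only [Valuation.restrict_lt_one_iff] using Valued.isOpen_ball (w.1.adicCompletion L) 1
  have hev : ∀ a b : Fin 2, ∀ᶠ h in 𝓝 h₀, Valued.v ((((h).1.val : GL (Fin 2) (UnitaryGroup.LocalRing L v)).val.map (Pi.evalRingHom (fun w' : PlacesOver L v => w'.1.adicCompletion L) w)) a b - (((h₀).1.val : GL (Fin 2) (UnitaryGroup.LocalRing L v)).val.map (Pi.evalRingHom (fun w' : PlacesOver L v => w'.1.adicCompletion L) w)) a b) < 1 := fun a b =>
    (hopen.preimage ((hcont a b).sub continuous_const)).mem_nhds (by simp)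
  have hall : ∀ᶠ h in 𝓝 h₀, ∀ a b : Fin 2, Valued.v ((((h).1.val : GL (Fin 2) (UnitaryGroup.LocalRing L v)).val.map (Pi.evalRingHom (fun w' : PlacesOver L v => w'.1.adicCompletion L) w)) a b - (((h₀).1.val : GL (Fin 2) (UnitaryGroup.LocalRing L v)).val.map (Pi.evalRingHom (fun w' : PlacesOver L v => w'.1.adicCompletion L) w)) a b) < 1 :=
    Filter.eventually_all.2 fun a => Filter.eventually_all.2 fun b => hev a b
  filter_upwards [hall] with h hh hmem
  ext a b
  exact red_eq_red_of_valuation_sub_lt_one (apply_mem_integer_of_mem L v w hw hmem a b) (apply_mem_integer_of_mem L v w hw hh₀ a b)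
    ((v_lt_one_iff_valuation_lt_one _).1 (hh a b))

set_option maxHeartbeats 400000 in
include hw in
/-- **`χ_s ∈ C_c^∞(H_v)`**: the class function `χ_s = 1_{K_H}·[(red h_{2,w} − 1)² = 0 ∧ rank(red h_{2,w} − 1) = s]` of HEAD v4 is locally constant with compact support,
for any `s` and ANY decidability instance of the condition (binder `χdec`: pass `_`). [cite: Rogawski1990, §4.9 Prop. 4.9.1 (b) p. 55] [cite: Kottwitz1986, §3] -/
theorem isLocSmooth_indicator_ite_redMat (s : ℕ) (χdec : ∀ h : ((cmDatum L 2 (Matrix.of fun i j : Fin 2 => if i.val + j.val + 1 = 2 then (1 : L) else 0)).Local v × (cmDatum L 1 (Matrix.of fun i j : Fin 1 => if i.val + j.val + 1 = 1 then (1 : L) else 0)).Local v), Decidable ((redMat (((h).1.val : GL (Fin 2) (UnitaryGroup.LocalRing L v)).val.map (Pi.evalRingHom (fun w' : PlacesOver L v => w'.1.adicCompletion L) w)) - 1) ^ 2 = 0 ∧ (redMat (((h).1.val : GL (Fin 2) (UnitaryGroup.LocalRing L v)).val.map (Pi.evalRingHom (fun w' : PlacesOver L v => w'.1.adicCompletion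 L) w)) - 1).rank = s)) :
    Literature.NumberTheory.Rogawski1990.IsLocSmooth (((((cmLocalIntegralLevel L 2 (Matrix.of fun i j : Fin 2 => if i.val + j.val + 1 = 2 then (1 : L) else 0) v).prod (cmLocalIntegralLevel L 1 (Matrix.of fun i j : Fin 1 => if i.val + j.val + 1 = 1 then (1 : L) else 0) v)) : Subgroup ((cmDatum L 2 (Matrix.of fun i j : Fin 2 => if i.val + j.val + 1 = 2 then (1 : L) else 0)).Local v × (cmDatum L 1 (Matrix.of fun i j : Fin 1 => if i.val + j.val + 1 = 1 then (1 : L) else 0)).Local v)) : Set ((cmDatum L 2 (Matrix.of fun i j : Fin 2 => if i.val + j.val + 1 = 2 then (1 : L) else 0)).Local v × (cmDatum L 1 (Matrix.of fun i j : Fin 1 => if i.val + j.val + 1 = 1 then (1 : L) else 0)).Local v)).indicator fun h => if (redMat (((h).1.val : GL (Fin 2) (UnitaryGroup.LocalRing L v)).val.map (Pi.evalRingHom (fun w' : PlacesOver L v => w'.1.adicCompletion L) w)) - 1) ^ 2 = 0 ∧ (redMat (((h).1.val : GL (Fin 2) (UnitaryGroup.LocalRing L v)).val.map (Pi.evalRingHom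 (fun w' : PlacesOver L v => w'.1.adicCompletion L) w)) - 1).rank = s then (1 : ℂ) else 0) := by
  obtain ⟨hKc, -⟩ := isCompact_and_interior_nonempty_prod_cmLocalIntegralLevel L v
  have hKo : IsOpen ((((cmLocalIntegralLevel L 2 (Matrix.of fun i j : Fin 2 => if i.val + j.val + 1 = 2 then (1 : L) else 0) v).prod (cmLocalIntegralLevel L 1 (Matrix.of fun i j : Fin 1 => if i.val + j.val + 1 = 1 then (1 : L) else 0) v)) : Subgroup ((cmDatum L 2 (Matrix.of fun i j : Fin 2 => if i.val + j.val + 1 = 2 then (1 : L) else 0)).Local v × (cmDatum L 1 (Matrix.of fun i j : Fin 1 => if i.val + j.val + 1 = 1 then (1 : L) else 0)).Local v)) : Set ((cmDatum L 2 (Matrix.of fun i j : Fin 2 => if i.val + j.val + 1 = 2 then (1 : L) else 0)).Local v × (cmDatum L 1 (Matrix.of fun i j : Fin 1 => if i.val + j.val + 1 = 1 then (1 : L) else 0)).Local v)) := by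
    rw [Subgroup.coe_prod]
    exact (isCompact_isOpen_cmLocalIntegralLevel L 2 (Matrix.of fun i j : Fin 2 => if i.val + j.val + 1 = 2 then (1 : L) else 0) v).2.prod (isCompact_isOpen_cmLocalIntegralLevel L 1 (Matrix.of fun i j : Fin 1 => if i.val + j.val + 1 = 1 then (1 : L) else 0) v).2
  have hKcl : IsClosed ((((cmLocalIntegralLevel L 2 (Matrix.of fun i j : Fin 2 => if i.val + j.val + 1 = 2 then (1 : L) else 0) v).prod (cmLocalIntegralLevel L 1 (Matrix.of fun i j : Fin 1 => if i.val + j.val + 1 = 1 then (1 : L) else 0) v)) : Subgroup ((cmDatum L 2 (Matrix.of fun i j : Fin 2 => if i.val + j.val + 1 = 2 then (1 : L) else 0)).Local v × (cmDatum L 1 (Matrix.of fun i j : Fin 1 => if i.val + j.val + 1 = 1 then (1 : L) else 0)).Local v)) : Set ((cmDatum L 2 (Matrix.of fun i j : Fin 2 => if i.val + j.val + 1 = 2 then (1 : L) else 0)).Local v × (cmDatum L 1 (Matrix.of fun i j : Fin 1 => if i.val + j.val + 1 = 1 then (1 : L) else 0)).Local v)) := Subgroup.isClosed_of_isOpen _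 hKo
  refine ⟨?_, HasCompactSupport.intro' hKc hKcl fun x hx => Set.indicator_of_notMem hx _⟩
  rw [IsLocallyConstant.iff_eventually_eq]
  intro h₀
  rcases Classical.em (h₀ ∈ ((((cmLocalIntegralLevel L 2 (Matrix.of fun i j : Fin 2 => if i.val + j.val + 1 = 2 then (1 : L) else 0) v).prod (cmLocalIntegralLevel L 1 (Matrix.of fun i j : Fin 1 => if i.val + j.val + 1 = 1 then (1 : L) else 0) v)) : Subgroup ((cmDatum L 2 (Matrix.of fun i j : Fin 2 => if i.val + j.val + 1 = 2 then (1 : L) else 0)).Local v × (cmDatum L 1 (Matrix.of fun i j : Fin 1 => if i.val + j.val + 1 = 1 then (1 : L) else 0)).Local v)) : Set ((cmDatum L 2 (Matrix.of fun i j : Fin 2 => if i.val + j.val + 1 = 2 then (1 : L) else 0)).Local v × (cmDatum L 1 (Matrix.of fun i j : Fin 1 => if i.val + j.val + 1 = 1 then (1 : L) else 0)).Local v))) with hh₀ | hh₀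
  · have hh₀' : h₀ ∈ (((cmLocalIntegralLevel L 2 (Matrix.of fun i j : Fin 2 => if i.val + j.val + 1 = 2 then (1 : L) else 0) v).prod (cmLocalIntegralLevel L 1 (Matrix.of fun i j : Fin 1 => if i.val + j.val + 1 = 1 then (1 : L) else 0) v)) : Subgroup ((cmDatum L 2 (Matrix.of fun i j : Fin 2 => if i.val + j.val + 1 = 2 then (1 : L) else 0)).Local v × (cmDatum L 1 (Matrix.of fun i j : Fin 1 => if i.val + j.val + 1 = 1 then (1 : L) else 0)).Local v)) := hh₀
    filter_upwards [hKo.mem_nhds hh₀, eventually_redMat_eq_of_mem L v w hw hh₀'] with h hh hred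
    have hh' : h ∈ (((cmLocalIntegralLevel L 2 (Matrix.of fun i j : Fin 2 => if i.val + j.val + 1 = 2 then (1 : L) else 0) v).prod (cmLocalIntegralLevel L 1 (Matrix.of fun i j : Fin 1 => if i.val + j.val + 1 = 1 then (1 : L) else 0) v)) : Subgroup ((cmDatum L 2 (Matrix.of fun i j : Fin 2 => if i.val + j.val + 1 = 2 then (1 : L) else 0)).Local v × (cmDatum L 1 (Matrix.of fun i j : Fin 1 => if i.val + j.val + 1 = 1 then (1 : L) else 0)).Local v)) := hh
    refine (Set.indicator_of_mem hh _).trans (Eq.trans ?_ (Set.indicator_of_mem hh₀ _).symm)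
    rcases @Decidable.em _ (χdec h₀) with hP | hP
    · have hP' := hP
      rw [← hred hh'] at hP'
      exact (if_pos hP').trans (if_pos hP).symm
    · have hP' := hP
      rw [← hred hh'] at hP'
      exact (if_neg hP').trans (if_neg hP).symm
  · filter_upwards [hKcl.isOpen_compl.mem_nhds hh₀] with h hh
    exact (Set.indicator_of_notMem hh _).trans (Set.indicator_of_notMem hh₀ _).symm

set_option maxHeartbeats 400000 in
include hw in
/-- **`χ_s` is `K_H`-conjugation invariant** (the Jordan type of the reduction is a `GL₂(𝒪_w)`-conjugation invariant: ★ `rank_redMat_conj_sub_one_eq`,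
★ `redMat_conj_sub_one_pow_eq_zero_iff`). [cite: Kottwitz1986, §3] [cite: Rogawski1990, §4.9 p. 54] -/
theorem indicator_ite_redMat_conj (s : ℕ) (χdec : ∀ h : ((cmDatum L 2 (Matrix.of fun i j : Fin 2 => if i.val + j.val + 1 = 2 then (1 : L) else 0)).Local v × (cmDatum L 1 (Matrix.of fun i j : Fin 1 => if i.val + j.val + 1 = 1 then (1 : L) else 0)).Local v), Decidable ((redMat (((h).1.val : GL (Fin 2) (UnitaryGroup.LocalRing L v)).val.map (Pi.evalRingHom (fun w' : PlacesOver L v => w'.1.adicCompletion L) w)) - 1) ^ 2 = 0 ∧ (redMat (((h).1.val : GL (Fin 2) (UnitaryGroup.LocalRing L v)).val.map (Pi.evalRingHom (fun w' : PlacesOver L v => w'.1.adicCompletion L) w)) - 1).rank = s)) :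
    ∀ k ∈ (((cmLocalIntegralLevel L 2 (Matrix.of fun i j : Fin 2 => if i.val + j.val + 1 = 2 then (1 : L) else 0) v).prod (cmLocalIntegralLevel L 1 (Matrix.of fun i j : Fin 1 => if i.val + j.val + 1 = 1 then (1 : L) else 0) v)) : Subgroup ((cmDatum L 2 (Matrix.of fun i j : Fin 2 => if i.val + j.val + 1 = 2 then (1 : L) else 0)).Local v × (cmDatum L 1 (Matrix.of fun i j : Fin 1 => if i.val + j.val + 1 = 1 then (1 : L) else 0)).Local v)), ∀ x : ((cmDatum L 2 (Matrix.of fun i j : Fin 2 => if i.val + j.val + 1 = 2 then (1 : L) else 0)).Local v × (cmDatum L 1 (Matrix.of fun i j : Fin 1 => if i.val + j.val + 1 = 1 then (1 : L) else 0)).Local v), (((((cmLocalIntegralLevel L 2 (Matrix.of fun i j : Fin 2 => if i.val + j.val + 1 = 2 then (1 : L) else 0) v).prod (cmLocalIntegralLevel L 1 (Matrix.of fun i j : Fin 1 => if i.val + j.val + 1 = 1 then (1 : L) else 0) v)) : Subgroup ((cmDatum L 2 (Matrix.of fun i j : Fin 2 => if i.val + j.val + 1 = 2 then (1 : L) else 0)).Local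 v × (cmDatum L 1 (Matrix.of fun i j : Fin 1 => if i.val + j.val + 1 = 1 then (1 : L) else 0)).Local v)) : Set ((cmDatum L 2 (Matrix.of fun i j : Fin 2 => if i.val + j.val + 1 = 2 then (1 : L) else 0)).Local v × (cmDatum L 1 (Matrix.of fun i j : Fin 1 => if i.val + j.val + 1 = 1 then (1 : L) else 0)).Local v)).indicator fun h => if (redMat (((h).1.val : GL (Fin 2) (UnitaryGroup.LocalRing L v)).val.map (Pi.evalRingHom (fun w' : PlacesOver L v => w'.1.adicCompletion L) w)) - 1) ^ 2 = 0 ∧ (redMat (((h).1.val : GL (Fin 2) (UnitaryGroup.LocalRing L v)).val.map (Pi.evalRingHom (fun w' : PlacesOver L v => w'.1.adicCompletion L) w)) - 1).rank = s then (1 : ℂ) else 0) (k * x * k⁻¹) = (((((cmLocalIntegralLevel L 2 (Matrix.of fun i j : Fin 2 => if i.val + j.val + 1 = 2 then (1 : L) else 0) v).prod (cmLocalIntegralLevel L 1 (Matrix.of fun i j : Fin 1 => if i.val + j.val + 1 = 1 then (1 : L) else 0) v)) : Subgroup ((cmDatum L 2 (Matrix.of fun i j : Fin 2 => if i.val + j.val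 + 1 = 2 then (1 : L) else 0)).Local v × (cmDatum L 1 (Matrix.of fun i j : Fin 1 => if i.val + j.val + 1 = 1 then (1 : L) else 0)).Local v)) : Set ((cmDatum L 2 (Matrix.of fun i j : Fin 2 => if i.val + j.val + 1 = 2 then (1 : L) else 0)).Local v × (cmDatum L 1 (Matrix.of fun i j : Fin 1 => if i.val + j.val + 1 = 1 then (1 : L) else 0)).Local v)).indicator fun h => if (redMat (((h).1.val : GL (Fin 2) (UnitaryGroup.LocalRing L v)).val.map (Pi.evalRingHom (fun w' : PlacesOver L v => w'.1.adicCompletion L) w)) - 1) ^ 2 = 0 ∧ (redMat (((h).1.val : GL (Fin 2) (UnitaryGroup.LocalRing L v)).val.map (Pi.evalRingHom (fun w' : PlacesOver L v => w'.1.adicCompletion L) w)) - 1).rank = s then (1 : ℂ) else 0) x := by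
  intro k hk x
  rcases Classical.em (x ∈ ((((cmLocalIntegralLevel L 2 (Matrix.of fun i j : Fin 2 => if i.val + j.val + 1 = 2 then (1 : L) else 0) v).prod (cmLocalIntegralLevel L 1 (Matrix.of fun i j : Fin 1 => if i.val + j.val + 1 = 1 then (1 : L) else 0) v)) : Subgroup ((cmDatum L 2 (Matrix.of fun i j : Fin 2 => if i.val + j.val + 1 = 2 then (1 : L) else 0)).Local v × (cmDatum L 1 (Matrix.of fun i j : Fin 1 => if i.val + j.val + 1 = 1 then (1 : L) else 0)).Local v)) : Set ((cmDatum L 2 (Matrix.of fun i j : Fin 2 => if i.val + j.val + 1 = 2 then (1 : L) else 0)).Local v × (cmDatum L 1 (Matrix.of fun i j : Fin 1 => if i.val + j.val + 1 = 1 then (1 : L) else 0)).Local v))) with hx | hx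
  · have hx' : x ∈ (((cmLocalIntegralLevel L 2 (Matrix.of fun i j : Fin 2 => if i.val + j.val + 1 = 2 then (1 : L) else 0) v).prod (cmLocalIntegralLevel L 1 (Matrix.of fun i j : Fin 1 => if i.val + j.val + 1 = 1 then (1 : L) else 0) v)) : Subgroup ((cmDatum L 2 (Matrix.of fun i j : Fin 2 => if i.val + j.val + 1 = 2 then (1 : L) else 0)).Local v × (cmDatum L 1 (Matrix.of fun i j : Fin 1 => if i.val + j.val + 1 = 1 then (1 : L) else 0)).Local v)) := hx
    have hkx : k * x * k⁻¹ ∈ ((((cmLocalIntegralLevel L 2 (Matrix.of fun i j : Fin 2 => if i.val + j.val + 1 = 2 then (1 : L) else 0) v).prod (cmLocalIntegralLevel L 1 (Matrix.of fun i j : Fin 1 => if i.val + j.val + 1 = 1 then (1 : L) else 0) v)) : Subgroup ((cmDatum L 2 (Matrix.of fun i j : Fin 2 => if i.val + j.val + 1 = 2 then (1 : L) else 0)).Local v × (cmDatum L 1 (Matrix.of fun i j : Fin 1 => if i.val + j.val + 1 = 1 then (1 : L) else 0)).Local v)) : Set ((cmDatum L 2 (Matrix.of fun i j : Fin 2 =>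 if i.val + j.val + 1 = 2 then (1 : L) else 0)).Local v × (cmDatum L 1 (Matrix.of fun i j : Fin 1 => if i.val + j.val + 1 = 1 then (1 : L) else 0)).Local v)) := mul_mem (mul_mem hk hx') (inv_mem hk)
    refine (Set.indicator_of_mem hkx _).trans (Eq.trans ?_ (Set.indicator_of_mem hx _).symm)
    -- the Jordan data of `(k x k⁻¹)_{2,w} = k′⁻¹ x_{2,w} k′`, `k′ = (k⁻¹)_{2,w} ∈ GL₂(𝒪_w)`
    have hkI := localNonsplitEquiv_fst_mem_glInt L v w hw (inv_mem hk : k⁻¹ ∈ (((cmLocalIntegralLevel L 2 (Matrix.of fun i j : Fin 2 => if i.val + j.val + 1 = 2 then (1 : L) else 0) v).prod (cmLocalIntegralLevel L 1 (Matrix.of fun i j : Fin 1 => if i.val + j.val + 1 = 1 then (1 : L) else 0) v)) : Subgroup ((cmDatum L 2 (Matrix.of fun i j : Fin 2 => if i.val + j.val + 1 = 2 then (1 : L) else 0)).Local v × (cmDatum L 1 (Matrix.of fun i j : Fin 1 => if i.val + j.val + 1 = 1 then (1 : L) else 0)).Local v)))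
    have hxI := localNonsplitEquiv_fst_mem_glInt L v w hw hx'
    have hrank := rank_redMat_conj_sub_one_eq hkI hxI
    have hpow := redMat_conj_sub_one_pow_eq_zero_iff hkI hxI 2
    rw [← map_fst_conj_eq L v w hw k x] at hrank hpow
    have hMW := coe_localNonsplitEquiv_apply L (Matrix.of fun i j : Fin 2 => if i.val + j.val + 1 = 2 then (1 : L) else 0) v w hw x.1
    rw [hMW] at hrank hpow
    rcases @Decidable.em _ (χdec x) with hP | hP
    · refine (if_pos ?_).trans (if_pos hP).symm
      exact ⟨hpow.2 hP.1, hrank.trans hP.2⟩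
    · refine (if_neg ?_).trans (if_neg hP).symm
      exact fun h => hP ⟨hpow.1 h.1, hrank.symm.trans h.2⟩
  · have hx' : x ∉ (((cmLocalIntegralLevel L 2 (Matrix.of fun i j : Fin 2 => if i.val + j.val + 1 = 2 then (1 : L) else 0) v).prod (cmLocalIntegralLevel L 1 (Matrix.of fun i j : Fin 1 => if i.val + j.val + 1 = 1 then (1 : L) else 0) v)) : Subgroup ((cmDatum L 2 (Matrix.of fun i j : Fin 2 => if i.val + j.val + 1 = 2 then (1 : L) else 0)).Local v × (cmDatum L 1 (Matrix.of fun i j : Fin 1 => if i.val + j.val + 1 = 1 then (1 : L) else 0)).Local v)) := hx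
    have hkx : k * x * k⁻¹ ∉ ((((cmLocalIntegralLevel L 2 (Matrix.of fun i j : Fin 2 => if i.val + j.val + 1 = 2 then (1 : L) else 0) v).prod (cmLocalIntegralLevel L 1 (Matrix.of fun i j : Fin 1 => if i.val + j.val + 1 = 1 then (1 : L) else 0) v)) : Subgroup ((cmDatum L 2 (Matrix.of fun i j : Fin 2 => if i.val + j.val + 1 = 2 then (1 : L) else 0)).Local v × (cmDatum L 1 (Matrix.of fun i j : Fin 1 => if i.val + j.val + 1 = 1 then (1 : L) else 0)).Local v)) : Set ((cmDatum L 2 (Matrix.of fun i j : Fin 2 => if i.val + j.val + 1 = 2 then (1 : L) else 0)).Local v × (cmDatum L 1 (Matrix.of fun i j : Fin 1 => if i.val + j.val + 1 = 1 then (1 : L) else 0)).Local v)) := fun h => hx' (by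
      have h' : k⁻¹ * (k * x * k⁻¹) * k ∈ (((cmLocalIntegralLevel L 2 (Matrix.of fun i j : Fin 2 => if i.val + j.val + 1 = 2 then (1 : L) else 0) v).prod (cmLocalIntegralLevel L 1 (Matrix.of fun i j : Fin 1 => if i.val + j.val + 1 = 1 then (1 : L) else 0) v)) : Subgroup ((cmDatum L 2 (Matrix.of fun i j : Fin 2 => if i.val + j.val + 1 = 2 then (1 : L) else 0)).Local v × (cmDatum L 1 (Matrix.of fun i j : Fin 1 => if i.val + j.val + 1 = 1 then (1 : L) else 0)).Local v)) := mul_mem (mul_mem (inv_mem hk) h) hk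
      rwa [← mul_assoc, ← mul_assoc, inv_mul_cancel, one_mul, mul_assoc, inv_mul_cancel, mul_one] at h')
    exact (Set.indicator_of_notMem hkx _).trans (Set.indicator_of_notMem hx _).symm

set_option maxHeartbeats 400000 in
/-- **`χ₀ + χ₁ = 1_{K_H}` AT A RESIDUALLY UNIPOTENT POINT**: if `h ∈ K_H ⇒ (red h_{2,w} − 1)² = 0`, then `χ₀ h + χ₁ h = 1_{K_H}(h)` (a `2 × 2` matrix of square zero has
rank `0` or `1`). [cite: Kottwitz1986, §3] -/
theorem indicator_ite_redMat_zero_add_one (χdec₀ : ∀ h : ((cmDatum L 2 (Matrix.of fun i j : Fin 2 => if i.val + j.val + 1 = 2 then (1 : L) else 0)).Local v × (cmDatum L 1 (Matrix.of fun i j : Fin 1 => if i.val + j.val + 1 = 1 then (1 : L) else 0)).Local v), Decidable ((redMat (((h).1.val : GL (Fin 2) (UnitaryGroup.LocalRing L v)).val.map (Pi.evalRingHom (fun w' : PlacesOver L v => w'.1.adicCompletion L) w)) - 1) ^ 2 = 0 ∧ (redMat (((h).1.val : GL (Fin 2) (UnitaryGroup.LocalRing L v)).val.map (Pi.evalRingHom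 (fun w' : PlacesOver L v => w'.1.adicCompletion L) w)) - 1).rank = 0)) (χdec₁ : ∀ h : ((cmDatum L 2 (Matrix.of fun i j : Fin 2 => if i.val + j.val + 1 = 2 then (1 : L) else 0)).Local v × (cmDatum L 1 (Matrix.of fun i j : Fin 1 => if i.val + j.val + 1 = 1 then (1 : L) else 0)).Local v), Decidable ((redMat (((h).1.val : GL (Fin 2) (UnitaryGroup.LocalRing L v)).val.map (Pi.evalRingHom (fun w' : PlacesOver L v => w'.1.adicCompletion L) w)) - 1) ^ 2 = 0 ∧ (redMat (((h).1.val : GL (Fin 2) (UnitaryGroup.LocalRing L v)).val.map (Pi.evalRingHom (fun w' : PlacesOver L v => w'.1.adicCompletion L) w)) - 1).rank = 1))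
    {h : ((cmDatum L 2 (Matrix.of fun i j : Fin 2 => if i.val + j.val + 1 = 2 then (1 : L) else 0)).Local v × (cmDatum L 1 (Matrix.of fun i j : Fin 1 => if i.val + j.val + 1 = 1 then (1 : L) else 0)).Local v)} (hh : h ∈ (((cmLocalIntegralLevel L 2 (Matrix.of fun i j : Fin 2 => if i.val + j.val + 1 = 2 then (1 : L) else 0) v).prod (cmLocalIntegralLevel L 1 (Matrix.of fun i j : Fin 1 => if i.val + j.val + 1 = 1 then (1 : L) else 0) v)) : Subgroup ((cmDatum L 2 (Matrix.of fun i j : Fin 2 => if i.val + j.val + 1 = 2 then (1 : L) else 0)).Local v × (cmDatum L 1 (Matrix.of fun i j : Fin 1 => if i.val + j.val + 1 = 1 then (1 : L) else 0)).Local v)) → (redMat (((h).1.val : GL (Fin 2) (UnitaryGroup.LocalRing L v)).val.map (Pi.evalRingHom (fun w' : PlacesOver L v => w'.1.adicCompletion L) w)) - 1) ^ 2 = 0) :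
    (((((cmLocalIntegralLevel L 2 (Matrix.of fun i j : Fin 2 => if i.val + j.val + 1 = 2 then (1 : L) else 0) v).prod (cmLocalIntegralLevel L 1 (Matrix.of fun i j : Fin 1 => if i.val + j.val + 1 = 1 then (1 : L) else 0) v)) : Subgroup ((cmDatum L 2 (Matrix.of fun i j : Fin 2 => if i.val + j.val + 1 = 2 then (1 : L) else 0)).Local v × (cmDatum L 1 (Matrix.of fun i j : Fin 1 => if i.val + j.val + 1 = 1 then (1 : L) else 0)).Local v)) : Set ((cmDatum L 2 (Matrix.of fun i j : Fin 2 => if i.val + j.val + 1 = 2 then (1 : L) else 0)).Local v × (cmDatum L 1 (Matrix.of fun i j : Fin 1 => if i.val + j.val + 1 = 1 then (1 : L) else 0)).Local v)).indicator fun h => if (redMat (((h).1.val : GL (Fin 2) (UnitaryGroup.LocalRing L v)).val.map (Pi.evalRingHom (fun w' : PlacesOver L v => w'.1.adicCompletion L) w)) - 1) ^ 2 = 0 ∧ (redMat (((h).1.val : GL (Fin 2) (UnitaryGroup.LocalRing L v)).val.map (Pi.evalRingHom (fun w' : PlacesOver L v => w'.1.adicCompletion L) w)) - 1).rank = 0 then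 (1 : ℂ) else 0) h + (((((cmLocalIntegralLevel L 2 (Matrix.of fun i j : Fin 2 => if i.val + j.val + 1 = 2 then (1 : L) else 0) v).prod (cmLocalIntegralLevel L 1 (Matrix.of fun i j : Fin 1 => if i.val + j.val + 1 = 1 then (1 : L) else 0) v)) : Subgroup ((cmDatum L 2 (Matrix.of fun i j : Fin 2 => if i.val + j.val + 1 = 2 then (1 : L) else 0)).Local v × (cmDatum L 1 (Matrix.of fun i j : Fin 1 => if i.val + j.val + 1 = 1 then (1 : L) else 0)).Local v)) : Set ((cmDatum L 2 (Matrix.of fun i j : Fin 2 => if i.val + j.val + 1 = 2 then (1 : L) else 0)).Local v × (cmDatum L 1 (Matrix.of fun i j : Fin 1 => if i.val + j.val + 1 = 1 then (1 : L) else 0)).Local v)).indicator fun h => if (redMat (((h).1.val : GL (Fin 2) (UnitaryGroup.LocalRing L v)).val.map (Pi.evalRingHom (fun w' : PlacesOver L v => w'.1.adicCompletion L) w)) - 1) ^ 2 = 0 ∧ (redMat (((h).1.val : GL (Fin 2) (UnitaryGroup.LocalRing L v)).val.map (Pi.evalRingHom (fun w' : PlacesOver L v => w'.1.adicCompletion L)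 w)) - 1).rank = 1 then (1 : ℂ) else 0) h = ((((cmLocalIntegralLevel L 2 (Matrix.of fun i j : Fin 2 => if i.val + j.val + 1 = 2 then (1 : L) else 0) v).prod (cmLocalIntegralLevel L 1 (Matrix.of fun i j : Fin 1 => if i.val + j.val + 1 = 1 then (1 : L) else 0) v)) : Subgroup ((cmDatum L 2 (Matrix.of fun i j : Fin 2 => if i.val + j.val + 1 = 2 then (1 : L) else 0)).Local v × (cmDatum L 1 (Matrix.of fun i j : Fin 1 => if i.val + j.val + 1 = 1 then (1 : L) else 0)).Local v)) : Set ((cmDatum L 2 (Matrix.of fun i j : Fin 2 => if i.val + j.val + 1 = 2 then (1 : L) else 0)).Local v × (cmDatum L 1 (Matrix.of fun i j : Fin 1 => if i.val + j.val + 1 = 1 then (1 : L) else 0)).Local v)).indicator (fun _ => (1 : ℂ)) h := by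
  rcases Classical.em (h ∈ ((((cmLocalIntegralLevel L 2 (Matrix.of fun i j : Fin 2 => if i.val + j.val + 1 = 2 then (1 : L) else 0) v).prod (cmLocalIntegralLevel L 1 (Matrix.of fun i j : Fin 1 => if i.val + j.val + 1 = 1 then (1 : L) else 0) v)) : Subgroup ((cmDatum L 2 (Matrix.of fun i j : Fin 2 => if i.val + j.val + 1 = 2 then (1 : L) else 0)).Local v × (cmDatum L 1 (Matrix.of fun i j : Fin 1 => if i.val + j.val + 1 = 1 then (1 : L) else 0)).Local v)) : Set ((cmDatum L 2 (Matrix.of fun i j : Fin 2 => if i.val + j.val + 1 = 2 then (1 : L) else 0)).Local v × (cmDatum L 1 (Matrix.of fun i j : Fin 1 => if i.val + j.val + 1 = 1 then (1 : L) else 0)).Local v))) with hK | hK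
  · have hnil := hh hK
    refine (congrArg₂ (· + ·) (Set.indicator_of_mem hK _) (Set.indicator_of_mem hK _)).trans (Eq.trans ?_ (Set.indicator_of_mem hK _).symm)
    rcases @Decidable.em _ (χdec₀ h) with h0 | h0 <;> rcases @Decidable.em _ (χdec₁ h) with h1 | h1
    · exact absurd (h0.2.symm.trans h1.2) zero_ne_one
    · exact (congrArg₂ (· + ·) (if_pos h0) (if_neg h1)).trans (add_zero _)
    · exact (congrArg₂ (· + ·) (if_neg h0) (if_pos h1)).trans (zero_add _)
    · exfalso
      rcases rank_eq_zero_or_eq_one_of_sq_eq_zero hnil with hr | hr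
      · exact h0 ⟨hnil, hr⟩
      · exact h1 ⟨hnil, hr⟩
  · exact (congrArg₂ (· + ·) (Set.indicator_of_notMem hK _) (Set.indicator_of_notMem hK _)).trans
      ((add_zero _).trans (Set.indicator_of_notMem hK _).symm)

set_option maxHeartbeats 400000 in
include hw in
/-- **DEEP ⇒ RESIDUALLY UNIPOTENT ON THE WHOLE STABLE ORBIT.**  For `γ_H = (g, u)` `G`-regular with split eigen-data `α ≠ γ` at `w` (roots of `χ_{g,w}`) and `α ≡ γ ≡ 1
(mod 𝔪_w)`: every `K_H`-point `y b y⁻¹` of the stable orbit of `γ_H` (`b` stably conjugate to `γ_H`) satisfies `(red((y b y⁻¹)_{2,w}) − 1)² = 0` — its characteristic polynomial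
at `w` is `(X − α)(X − γ) ≡ (X − 1)²` (★ (E1) eigenframe, ★ `charpoly_eq_of_isConj_units`) and Cayley–Hamilton (★ A-p12 `redMat_sub_one_pow_eq_zero_of_deep`).
[cite: Kottwitz1986, §3] [cite: Rogawski1990, §3.6 p. 31; §4.9 p. 54] -/
theorem sq_redMat_sub_one_eq_zero_of_isLocalStablyConjH
    {γH : (cmDatum L 2 (Matrix.of fun i j : Fin 2 => if i.val + j.val + 1 = 2 then (1 : L) else 0)).Local v × (cmDatum L 1 (Matrix.of fun i j : Fin 1 => if i.val + j.val + 1 = 1 then (1 : L) else 0)).Local v} (hreg : IsLocalGRegular L v γH) (α γ : (w.1.adicCompletion L))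
    (hα : ((((γH.1.val : GL (Fin 2) (LocalRing L v)) : Matrix (Fin 2) (Fin 2) (LocalRing L v)).charpoly).map (Pi.evalRingHom (fun w' : PlacesOver L v => w'.1.adicCompletion L) w)).IsRoot α)
    (hγ : ((((γH.1.val : GL (Fin 2) (LocalRing L v)) : Matrix (Fin 2) (Fin 2) (LocalRing L v)).charpoly).map (Pi.evalRingHom (fun w' : PlacesOver L v => w'.1.adicCompletion L) w)).IsRoot γ)
    (hαγ : α ≠ γ) (hα1 : Valued.v (α - 1) < 1) (hγ1 : Valued.v (γ - 1) < 1)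
    {b : ((cmDatum L 2 (Matrix.of fun i j : Fin 2 => if i.val + j.val + 1 = 2 then (1 : L) else 0)).Local v × (cmDatum L 1 (Matrix.of fun i j : Fin 1 => if i.val + j.val + 1 = 1 then (1 : L) else 0)).Local v)} (hb : IsLocalStablyConjH L v γH b) (y : ((cmDatum L 2 (Matrix.of fun i j : Fin 2 => if i.val + j.val + 1 = 2 then (1 : L) else 0)).Local v × (cmDatum L 1 (Matrix.of fun i j : Fin 1 => if i.val + j.val + 1 = 1 then (1 : L) else 0)).Local v)) (hy : y * b * y⁻¹ ∈ (((cmLocalIntegralLevel L 2 (Matrix.of fun i j : Fin 2 => if i.val + j.val + 1 = 2 then (1 : L) else 0) v).prod (cmLocalIntegralLevel L 1 (Matrix.of fun i j : Fin 1 => if i.val + j.val + 1 = 1 then (1 : L) else 0) v)) : Subgroup ((cmDatum L 2 (Matrix.of fun i j : Fin 2 => if i.val + j.val + 1 = 2 then (1 : L) else 0)).Local v × (cmDatum L 1 (Matrix.of fun i j : Fin 1 => if i.val + j.val + 1 = 1 then (1 : L) else 0)).Local v))) :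
    (redMat (((y * b * y⁻¹).1.val : GL (Fin 2) (UnitaryGroup.LocalRing L v)).val.map (Pi.evalRingHom (fun w' : PlacesOver L v => w'.1.adicCompletion L) w)) - 1) ^ 2 = 0 := by
  -- (E1) the eigenframe of `g` through the root `α`; the second eigenvalue at `w` is `γ`
  have hsep : (((γH.1.val : GL (Fin 2) (LocalRing L v)) : Matrix (Fin 2) (Fin 2) (LocalRing L v)).charpoly).Separable :=
    (isRegularElt_fst_snd_of_isLocalGRegular L v γH hreg).1
  obtain ⟨P, u, hP, hu, hu0⟩ := exists_eigenframe_cmDatum_local_of_isRoot_map_of_separable L v w hw γH.1 hα hsep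
  have hu1w : u 1 w = γ := by
    rcases eq_or_eq_eval_of_isRoot_of_eigenframe L v w hP hγ with h | h
    · exact absurd (h.trans hu0) (Ne.symm hαγ)
    · exact h.symm
  -- `χ_g = (X − u₀)(X − u₁)` over `E_v`
  have hconj : (P⁻¹).val * (γH.1.val : GL (Fin 2) (LocalRing L v)).val * P.val = diagonal u := by
    rw [Matrix.mul_assoc, hP, ← Matrix.mul_assoc, Units.inv_mul, Matrix.one_mul]
  have hchar : ((γH.1.val : GL (Fin 2) (LocalRing L v)) : Matrix (Fin 2) (Fin 2) (LocalRing L v)).charpoly = ∏ i : Fin 2, (X - C (u i)) := by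
    rw [← Matrix.charpoly_units_conj' P (γH.1.val : GL (Fin 2) (LocalRing L v)).val, ← Matrix.coe_units_inv, hconj, Matrix.charpoly_diagonal]
  -- `b.1` is `GL`-conjugate to `g`: same characteristic polynomial
  have hcharb : ((b.1.val : GL (Fin 2) (LocalRing L v)) : Matrix (Fin 2) (Fin 2) (LocalRing L v)).charpoly =
      ((γH.1.val : GL (Fin 2) (LocalRing L v)) : Matrix (Fin 2) (Fin 2) (LocalRing L v)).charpoly :=
    (charpoly_eq_of_isConj_units hb.1).symm
  -- deepness at `w`: `χ_{b,w} − (X − 1)²` has coefficients in `𝔪_w`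
  have ht : ∀ m : ℕ, valuation (w.1.adicCompletion L)
      (((((b.1.val : GL (Fin 2) (LocalRing L v)).val.map (Pi.evalRingHom (fun w' : PlacesOver L v => w'.1.adicCompletion L) w))).charpoly -
        (Polynomial.X - 1) ^ 2).coeff m) < 1 := by
    intro m
    rw [Matrix.charpoly_map, hcharb, hchar, Polynomial.map_prod, Fin.prod_univ_two]
    simp only [Polynomial.map_sub, Polynomial.map_X, Polynomial.map_C, Pi.evalRingHom_apply]
    rw [hu0, hu1w]
    exact valuation_coeff_mul_sub_sq_lt_one (valuation (w.1.adicCompletion L)) ((v_lt_one_iff_valuation_lt_one _).1 hα1) ((v_lt_one_iff_valuation_lt_one _).1 hγ1) m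
  -- ★ A-p12: Cayley–Hamilton on the fixed `K₂`-conjugate `y₂ b₂ y₂⁻¹ = (y₂⁻¹)⁻¹ b₂ (y₂⁻¹)`
  have hy2 : y.1⁻¹⁻¹ * b.1 * y.1⁻¹ ∈ cmLocalIntegralLevel L 2 (Matrix.of fun i j : Fin 2 => if i.val + j.val + 1 = 2 then (1 : L) else 0) v := by
    rw [inv_inv]; exact (Subgroup.mem_prod.1 hy).1
  have key := redMat_sub_one_pow_eq_zero_of_deep L 2 (Matrix.of fun i j : Fin 2 => if i.val + j.val + 1 = 2 then (1 : L) else 0) v w hw b.1 ht y.1⁻¹ hy2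
  have hfst : (y * b * y⁻¹).1 = y.1⁻¹⁻¹ * b.1 * y.1⁻¹ := by rw [inv_inv]; rfl
  rw [hfst]
  exact key

end Place

/-! ## §3 The two heads of T3′'s H-side, type (1) -/

section Heads

variable (L : Type) [Field L] [NumberField L] [IsCMField L] (v : HeightOneSpectrum (𝓞 ↥(maximalRealSubfield L)))
  (w : PlacesOver L v) (hw : IsCMField.complexConj L • w.1 = w.1)
  [MeasurableSpace ((cmDatum L 2 (Matrix.of fun i j : Fin 2 => if i.val + j.val + 1 = 2 then (1 : L) else 0)).Local v × (cmDatum L 1 (Matrix.of fun i j : Fin 1 => if i.val + j.val + 1 = 1 then (1 : L) else 0)).Local v)] [BorelSpace ((cmDatum L 2 (Matrix.of fun i j : Fin 2 => if i.val + j.val + 1 = 2 then (1 : L) else 0)).Local v × (cmDatum L 1 (Matrix.of fun i j : Fin 1 => if i.val + j.val + 1 = 1 then (1 : L) else 0)).Local v)]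
  [∀ a : (cmDatum L 2 (Matrix.of fun i j : Fin 2 => if i.val + j.val + 1 = 2 then (1 : L) else 0)).Local v × (cmDatum L 1 (Matrix.of fun i j : Fin 1 => if i.val + j.val + 1 = 1 then (1 : L) else 0)).Local v, MeasurableSpace (((cmDatum L 2 (Matrix.of fun i j : Fin 2 => if i.val + j.val + 1 = 2 then (1 : L) else 0)).Local v × (cmDatum L 1 (Matrix.of fun i j : Fin 1 => if i.val + j.val + 1 = 1 then (1 : L) else 0)).Local v) ⧸ Subgroup.centralizer ({a} : Set ((cmDatum L 2 (Matrix.of fun i j : Fin 2 => if i.val + j.val + 1 = 2 then (1 : L) else 0)).Local v × (cmDatum L 1 (Matrix.of fun i j : Fin 1 => if i.val + j.val + 1 = 1 then (1 : L) else 0)).Local v)))]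
  [∀ a : (cmDatum L 2 (Matrix.of fun i j : Fin 2 => if i.val + j.val + 1 = 2 then (1 : L) else 0)).Local v × (cmDatum L 1 (Matrix.of fun i j : Fin 1 => if i.val + j.val + 1 = 1 then (1 : L) else 0)).Local v, BorelSpace (((cmDatum L 2 (Matrix.of fun i j : Fin 2 => if i.val + j.val + 1 = 2 then (1 : L) else 0)).Local v × (cmDatum L 1 (Matrix.of fun i j : Fin 1 => if i.val + j.val + 1 = 1 then (1 : L) else 0)).Local v) ⧸ Subgroup.centralizer ({a} : Set ((cmDatum L 2 (Matrix.of fun i j : Fin 2 => if i.val + j.val + 1 = 2 then (1 : L) else 0)).Local v × (cmDatum L 1 (Matrix.of fun i j : Fin 1 => if i.val + j.val + 1 = 1 then (1 : L) else 0)).Local v)))]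
  (νH : Measure ((cmDatum L 2 (Matrix.of fun i j : Fin 2 => if i.val + j.val + 1 = 2 then (1 : L) else 0)).Local v × (cmDatum L 1 (Matrix.of fun i j : Fin 1 => if i.val + j.val + 1 = 1 then (1 : L) else 0)).Local v)) [νH.IsHaarMeasure] [νH.IsMulRightInvariant]

set_option maxHeartbeats 400000 in
include hw in
/-- **O8c HEAD (χ₀): `Φ^st(γ_H, χ₀) = ν_H(K_H) · phiH q (N − 1)`** for HEAD v4's `χ₀ = 1_{K_H}·[(red h_{W,w} − 1)² = 0 ∧ rank(red h_{W,w} − 1) = 0]`, at a deep `G`-regular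
elliptic `γ_H` of type (1) (split eigen-data `α ≠ γ`, `N = ord_w(α − γ)`, `α ≡ γ ≡ 1 (mod 𝔪_w)`), ANY Haar `ν_H` and canonical `m_H`: the ROW-0 bridge (§1) identifies `χ₀`
with the level-`ϖ_w` class function of ★ FILE A `stableOrbitalIntegralRel_level_eq_mul_phiH_of_isRoot` at `i = 1` (law C1: the fixed ball of radius `N − 1`).  The
decidability instance of the `if` is a binder (`χdec`: pass `_`, unification takes the consumer's). [cite: Flicker1998UnitaryFL, §6 p. 95]
[cite: Rogawski1990, §4.9 Prop. 4.9.1 (b) p. 55; §4.3 (4.3.1) p. 43] [cite: Kottwitz1986, §3] -/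
theorem stableOrbitalIntegralRel_chiZero_eq_mul_phiH_of_isRoot (hv : Algebra.IsUnramifiedIn (𝓞 L) v.asIdeal)
    {mH : OrbitalMeasureFamily ((cmDatum L 2 (Matrix.of fun i j : Fin 2 => if i.val + j.val + 1 = 2 then (1 : L) else 0)).Local v × (cmDatum L 1 (Matrix.of fun i j : Fin 1 => if i.val + j.val + 1 = 1 then (1 : L) else 0)).Local v)} (hmH : mH.IsCanonical (IsLocalGRegular L v) νH)
    {γH : (cmDatum L 2 (Matrix.of fun i j : Fin 2 => if i.val + j.val + 1 = 2 then (1 : L) else 0)).Local v × (cmDatum L 1 (Matrix.of fun i j : Fin 1 => if i.val + j.val + 1 = 1 then (1 : L) else 0)).Local v} (hreg : IsLocalGRegular L v γH)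
    (hell : ¬ ∃ (y : ((cmDatum L 2 (Matrix.of fun i j : Fin 2 => if i.val + j.val + 1 = 2 then (1 : L) else 0)).Local v × (cmDatum L 1 (Matrix.of fun i j : Fin 1 => if i.val + j.val + 1 = 1 then (1 : L) else 0)).Local v)) (d' : Fin 2 → (UnitaryGroup.LocalRing L v)ˣ),
        glDiagonal 2 (UnitaryGroup.LocalRing L v) d' = ((y * γH * y⁻¹).1.val : GL (Fin 2) (UnitaryGroup.LocalRing L v)))
    (α γ : (w.1.adicCompletion L))
    (hα : ((((γH.1.val : GL (Fin 2) (LocalRing L v)) : Matrix (Fin 2) (Fin 2) (LocalRing L v)).charpoly).map (Pi.evalRingHom (fun w' : PlacesOver L v => w'.1.adicCompletion L) w)).IsRoot α)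
    (hγ : ((((γH.1.val : GL (Fin 2) (LocalRing L v)) : Matrix (Fin 2) (Fin 2) (LocalRing L v)).charpoly).map (Pi.evalRingHom (fun w' : PlacesOver L v => w'.1.adicCompletion L) w)).IsRoot γ)
    (hαγ : α ≠ γ) (N : ℕ) (hN : Valued.v (α - γ) = WithZero.exp (-(N : ℤ)))
    (hα1 : Valued.v (α - 1) < 1) (hγ1 : Valued.v (γ - 1) < 1)
    (χdec : ∀ h : ((cmDatum L 2 (Matrix.of fun i j : Fin 2 => if i.val + j.val + 1 = 2 then (1 : L) else 0)).Local v × (cmDatum L 1 (Matrix.of fun i j : Fin 1 => if i.val + j.val + 1 = 1 then (1 : L) else 0)).Local v), Decidable ((redMat (((h).1.val : GL (Fin 2) (UnitaryGroup.LocalRing L v)).val.map (Pi.evalRingHom (fun w' : PlacesOver L v => w'.1.adicCompletion L) w)) - 1) ^ 2 = 0 ∧ (redMat (((h).1.val : GL (Fin 2) (UnitaryGroup.LocalRing L v)).val.map (Pi.evalRingHom (fun w' : PlacesOver L v => w'.1.adicCompletion L) w)) - 1).rank = 0)) :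
    stableOrbitalIntegralRel (IsLocalStablyConjH L v) mH (((((cmLocalIntegralLevel L 2 (Matrix.of fun i j : Fin 2 => if i.val + j.val + 1 = 2 then (1 : L) else 0) v).prod (cmLocalIntegralLevel L 1 (Matrix.of fun i j : Fin 1 => if i.val + j.val + 1 = 1 then (1 : L) else 0) v)) : Subgroup ((cmDatum L 2 (Matrix.of fun i j : Fin 2 => if i.val + j.val + 1 = 2 then (1 : L) else 0)).Local v × (cmDatum L 1 (Matrix.of fun i j : Fin 1 => if i.val + j.val + 1 = 1 then (1 : L) else 0)).Local v)) : Set ((cmDatum L 2 (Matrix.of fun i j : Fin 2 => if i.val + j.val + 1 = 2 then (1 : L) else 0)).Local v × (cmDatum L 1 (Matrix.of fun i j : Fin 1 => if i.val + j.val + 1 = 1 then (1 : L) else 0)).Local v)).indicator fun h => if (redMat (((h).1.val : GL (Fin 2) (UnitaryGroup.LocalRing L v)).val.map (Pi.evalRingHom (fun w' : PlacesOver L v => w'.1.adicCompletion L) w)) - 1) ^ 2 = 0 ∧ (redMat (((h).1.val : GL (Fin 2) (UnitaryGroup.LocalRing L v)).val.map (Pi.evalRingHom (fun w' : PlacesOver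 L v => w'.1.adicCompletion L) w)) - 1).rank = 0 then (1 : ℂ) else 0) γH =
      (νH.real ((((cmLocalIntegralLevel L 2 (Matrix.of fun i j : Fin 2 => if i.val + j.val + 1 = 2 then (1 : L) else 0) v).prod (cmLocalIntegralLevel L 1 (Matrix.of fun i j : Fin 1 => if i.val + j.val + 1 = 1 then (1 : L) else 0) v)) : Subgroup ((cmDatum L 2 (Matrix.of fun i j : Fin 2 => if i.val + j.val + 1 = 2 then (1 : L) else 0)).Local v × (cmDatum L 1 (Matrix.of fun i j : Fin 1 => if i.val + j.val + 1 = 1 then (1 : L) else 0)).Local v)) : Set ((cmDatum L 2 (Matrix.of fun i j : Fin 2 => if i.val + j.val + 1 = 2 then (1 : L) else 0)).Local v × (cmDatum L 1 (Matrix.of fun i j : Fin 1 => if i.val + j.val + 1 = 1 then (1 : L) else 0)).Local v)) : ℂ) * ((Flicker1998.phiH (Ideal.absNorm v.asIdeal) (N - 1) : ℚ) : ℂ) := by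
  -- the uniformizer `ϖ_w`
  have hϖ1 := Liu2021.LemD1IndexedNonVacuityInertCofinite.valued_toPlace_uniformizer_of_isUnramifiedIn L v hv w
  have hϖ := isUniformizingElement_of_v_eq hϖ1
  -- `N ≥ 1` and `|γ − 1| ≤ |ϖ_w|` from deepness
  have hN1 : 1 ≤ N := by
    have hlt : Valued.v (α - γ) < 1 := by
      have e : α - γ = (α - 1) - (γ - 1) := by ring
      rw [e]
      exact lt_of_le_of_lt (Valuation.map_sub _ _ _) (max_lt hα1 hγ1)
    rw [hN, ← WithZero.exp_zero, WithZero.exp_lt_exp] at hlt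
    omega
  have hγi : Valued.v (γ - 1) ≤ WithZero.exp (-((1 : ℕ) : ℤ)) := by
    -- in `ℤᵐ⁰`: `x < 1 ↔ x ≤ exp (−1)` (cf. ★ `WithZero.lt_one_iff_le_exp_neg_one` in `NewformAdelisationHeckeCosets`, not imported here)
    have h := WithZero.lt_mul_exp_iff_le (x := Valued.v (γ - 1)) (y := WithZero.exp (-1 : ℤ)) WithZero.exp_ne_zero
    rw [← WithZero.exp_add, show (-1 : ℤ) + 1 = 0 by norm_num, WithZero.exp_zero] at h
    rw [Nat.cast_one]
    exact h.1 hγ1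
  -- ★ FILE A at `i = 1`, with `χ₀` as the level-`ϖ_w` class function (ROW-0 bridge)
  refine stableOrbitalIntegralRel_level_eq_mul_phiH_of_isRoot L v w hw νH hv hmH hreg hell α γ hα hγ hαγ N hN (i := 1) le_rfl hN1 hγi _
    (isLocSmooth_indicator_ite_redMat L v w hw 0 χdec).continuous Set.support_indicator_subset (indicator_ite_redMat_conj L v w hw 0 χdec) ?_ ?_
  · intro x hx hlev
    have hx' : x ∈ ((((cmLocalIntegralLevel L 2 (Matrix.of fun i j : Fin 2 => if i.val + j.val + 1 = 2 then (1 : L) else 0) v).prod (cmLocalIntegralLevel L 1 (Matrix.of fun i j : Fin 1 => if i.val + j.val + 1 = 1 then (1 : L) else 0) v)) : Subgroup ((cmDatum L 2 (Matrix.of fun i j : Fin 2 => if i.val + j.val + 1 = 2 then (1 : L) else 0)).Local v × (cmDatum L 1 (Matrix.of fun i j : Fin 1 => if i.val + j.val + 1 = 1 then (1 : L) else 0)).Local v)) : Set ((cmDatum L 2 (Matrix.of fun i j : Fin 2 => if i.val + j.val + 1 = 2 then (1 : L) else 0)).Local v × (cmDatum L 1 (Matrix.of fun i j : Fin 1 =>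 if i.val + j.val + 1 = 1 then (1 : L) else 0)).Local v)) := hx
    have hMW := coe_localNonsplitEquiv_apply L (Matrix.of fun i j : Fin 2 => if i.val + j.val + 1 = 2 then (1 : L) else 0) v w hw x.1
    have hb := sq_eq_zero_and_rank_eq_zero_iff_forall_valuation_le hϖ (localNonsplitEquiv_fst_mem_glInt L v w hw hx)
    rw [pow_one, hMW] at hlev
    rw [hMW] at hb
    exact (Set.indicator_of_mem hx' _).trans (if_pos (hb.2 hlev))
  · intro x hx hlev
    have hx' : x ∈ ((((cmLocalIntegralLevel L 2 (Matrix.of fun i j : Fin 2 => if i.val + j.val + 1 = 2 then (1 : L) else 0) v).prod (cmLocalIntegralLevel L 1 (Matrix.of fun i j : Fin 1 => if i.val + j.val + 1 = 1 then (1 : L) else 0) v)) : Subgroup ((cmDatum L 2 (Matrix.of fun i j : Fin 2 => if i.val + j.val + 1 = 2 then (1 : L) else 0)).Local v × (cmDatum L 1 (Matrix.of fun i j : Fin 1 => if i.val + j.val + 1 = 1 then (1 : L) else 0)).Local v)) : Set ((cmDatum L 2 (Matrix.of fun i j : Fin 2 => if i.val + j.val + 1 = 2 then (1 : L) else 0)).Local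 v × (cmDatum L 1 (Matrix.of fun i j : Fin 1 => if i.val + j.val + 1 = 1 then (1 : L) else 0)).Local v)) := hx
    have hMW := coe_localNonsplitEquiv_apply L (Matrix.of fun i j : Fin 2 => if i.val + j.val + 1 = 2 then (1 : L) else 0) v w hw x.1
    have hb := sq_eq_zero_and_rank_eq_zero_iff_forall_valuation_le hϖ (localNonsplitEquiv_fst_mem_glInt L v w hw hx)
    rw [pow_one, hMW] at hlev
    rw [hMW] at hb
    exact (Set.indicator_of_mem hx' _).trans (if_neg fun hP => hlev (hb.1 hP))

set_option maxHeartbeats 400000 in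
include hw in
/-- **O8c HEAD (χ₁): `Φ^st(γ_H, χ₁) = ν_H(K_H) · (phiH q N − phiH q (N − 1))`** (`= ν_H(K_H)·q^{N−1}(q+1)`, the fixed vertices at exact distance `N`) for HEAD v4's
`χ₁ = 1_{K_H}·[(red h_{W,w} − 1)² = 0 ∧ rank(red h_{W,w} − 1) = 1]`, same frame as the `χ₀` head: on the stable orbit of the deep `γ_H` every `K_H`-point is residually
unipotent (§2), so `χ₀ + χ₁ = 1_{K_H}` there, `Φ^st` only sees the orbit (★ `stableOrbitalIntegralRel_congr_fun_of_eqOn`), `χ₀, χ₁ ∈ C_c^∞` (§2) give additivity (★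
`localStableOrbitalIntegralH_add_of_isLocSmooth`), and `Φ^st(1_{K_H}) = ν_H(K_H)·phiH q N` (★ FILE A).  Decidability binders `χdec₀ χdec₁` (any instances: pass `_`).
[cite: Flicker1998UnitaryFL, §6 p. 95] [cite: Rogawski1990, §4.9 Prop. 4.9.1 (b) p. 55, Lemma 4.9.3 p. 56; §4.3 (4.3.1) p. 43] [cite: Kottwitz1986, §3] -/
theorem stableOrbitalIntegralRel_chiOne_eq_mul_phiH_sub_of_isRoot (hv : Algebra.IsUnramifiedIn (𝓞 L) v.asIdeal)
    {mH : OrbitalMeasureFamily ((cmDatum L 2 (Matrix.of fun i j : Fin 2 => if i.val + j.val + 1 = 2 then (1 : L) else 0)).Local v × (cmDatum L 1 (Matrix.of fun i j : Fin 1 => if i.val + j.val + 1 = 1 then (1 : L) else 0)).Local v)} (hmH : mH.IsCanonical (IsLocalGRegular L v) νH)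
    {γH : (cmDatum L 2 (Matrix.of fun i j : Fin 2 => if i.val + j.val + 1 = 2 then (1 : L) else 0)).Local v × (cmDatum L 1 (Matrix.of fun i j : Fin 1 => if i.val + j.val + 1 = 1 then (1 : L) else 0)).Local v} (hreg : IsLocalGRegular L v γH)
    (hell : ¬ ∃ (y : ((cmDatum L 2 (Matrix.of fun i j : Fin 2 => if i.val + j.val + 1 = 2 then (1 : L) else 0)).Local v × (cmDatum L 1 (Matrix.of fun i j : Fin 1 => if i.val + j.val + 1 = 1 then (1 : L) else 0)).Local v)) (d' : Fin 2 → (UnitaryGroup.LocalRing L v)ˣ),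
        glDiagonal 2 (UnitaryGroup.LocalRing L v) d' = ((y * γH * y⁻¹).1.val : GL (Fin 2) (UnitaryGroup.LocalRing L v)))
    (α γ : (w.1.adicCompletion L))
    (hα : ((((γH.1.val : GL (Fin 2) (LocalRing L v)) : Matrix (Fin 2) (Fin 2) (LocalRing L v)).charpoly).map (Pi.evalRingHom (fun w' : PlacesOver L v => w'.1.adicCompletion L) w)).IsRoot α)
    (hγ : ((((γH.1.val : GL (Fin 2) (LocalRing L v)) : Matrix (Fin 2) (Fin 2) (LocalRing L v)).charpoly).map (Pi.evalRingHom (fun w' : PlacesOver L v => w'.1.adicCompletion L) w)).IsRoot γ)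
    (hαγ : α ≠ γ) (N : ℕ) (hN : Valued.v (α - γ) = WithZero.exp (-(N : ℤ)))
    (hα1 : Valued.v (α - 1) < 1) (hγ1 : Valued.v (γ - 1) < 1)
    (χdec₀ : ∀ h : ((cmDatum L 2 (Matrix.of fun i j : Fin 2 => if i.val + j.val + 1 = 2 then (1 : L) else 0)).Local v × (cmDatum L 1 (Matrix.of fun i j : Fin 1 => if i.val + j.val + 1 = 1 then (1 : L) else 0)).Local v), Decidable ((redMat (((h).1.val : GL (Fin 2) (UnitaryGroup.LocalRing L v)).val.map (Pi.evalRingHom (fun w' : PlacesOver L v => w'.1.adicCompletion L) w)) - 1) ^ 2 = 0 ∧ (redMat (((h).1.val : GL (Fin 2) (UnitaryGroup.LocalRing L v)).val.map (Pi.evalRingHom (fun w' : PlacesOver L v => w'.1.adicCompletion L) w)) - 1).rank = 0)) (χdec₁ : ∀ h : ((cmDatum L 2 (Matrix.of fun i j : Fin 2 => if i.val + j.val + 1 = 2 then (1 : L) else 0)).Local v × (cmDatum L 1 (Matrix.of fun i j : Fin 1 => if i.val + j.val + 1 = 1 then (1 : L) else 0)).Local v), Decidable ((redMat (((h).1.val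 : GL (Fin 2) (UnitaryGroup.LocalRing L v)).val.map (Pi.evalRingHom (fun w' : PlacesOver L v => w'.1.adicCompletion L) w)) - 1) ^ 2 = 0 ∧ (redMat (((h).1.val : GL (Fin 2) (UnitaryGroup.LocalRing L v)).val.map (Pi.evalRingHom (fun w' : PlacesOver L v => w'.1.adicCompletion L) w)) - 1).rank = 1)) :
    stableOrbitalIntegralRel (IsLocalStablyConjH L v) mH (((((cmLocalIntegralLevel L 2 (Matrix.of fun i j : Fin 2 => if i.val + j.val + 1 = 2 then (1 : L) else 0) v).prod (cmLocalIntegralLevel L 1 (Matrix.of fun i j : Fin 1 => if i.val + j.val + 1 = 1 then (1 : L) else 0) v)) : Subgroup ((cmDatum L 2 (Matrix.of fun i j : Fin 2 => if i.val + j.val + 1 = 2 then (1 : L) else 0)).Local v × (cmDatum L 1 (Matrix.of fun i j : Fin 1 => if i.val + j.val + 1 = 1 then (1 : L) else 0)).Local v)) : Set ((cmDatum L 2 (Matrix.of fun i j : Fin 2 => if i.val + j.val + 1 = 2 then (1 : L) else 0)).Local v × (cmDatum L 1 (Matrix.of fun i j : Fin 1 => if i.val + j.val + 1 = 1 then (1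 : L) else 0)).Local v)).indicator fun h => if (redMat (((h).1.val : GL (Fin 2) (UnitaryGroup.LocalRing L v)).val.map (Pi.evalRingHom (fun w' : PlacesOver L v => w'.1.adicCompletion L) w)) - 1) ^ 2 = 0 ∧ (redMat (((h).1.val : GL (Fin 2) (UnitaryGroup.LocalRing L v)).val.map (Pi.evalRingHom (fun w' : PlacesOver L v => w'.1.adicCompletion L) w)) - 1).rank = 1 then (1 : ℂ) else 0) γH =
      (νH.real ((((cmLocalIntegralLevel L 2 (Matrix.of fun i j : Fin 2 => if i.val + j.val + 1 = 2 then (1 : L) else 0) v).prod (cmLocalIntegralLevel L 1 (Matrix.of fun i j : Fin 1 => if i.val + j.val + 1 = 1 then (1 : L) else 0) v)) : Subgroup ((cmDatum L 2 (Matrix.of fun i j : Fin 2 => if i.val + j.val + 1 = 2 then (1 : L) else 0)).Local v × (cmDatum L 1 (Matrix.of fun i j : Fin 1 => if i.val + j.val + 1 = 1 then (1 : L) else 0)).Local v)) : Set ((cmDatum L 2 (Matrix.of fun i j : Fin 2 => if i.val + j.val + 1 = 2 then (1 : L) else 0)).Local v × (cmDatum L 1 (Matrix.of fun i j : Fin 1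 => if i.val + j.val + 1 = 1 then (1 : L) else 0)).Local v)) : ℂ) * ((Flicker1998.phiH (Ideal.absNorm v.asIdeal) N - Flicker1998.phiH (Ideal.absNorm v.asIdeal) (N - 1) : ℚ) : ℂ) := by
  have h0 := isLocSmooth_indicator_ite_redMat L v w hw 0 χdec₀
  have h1 := isLocSmooth_indicator_ite_redMat L v w hw 1 χdec₁
  -- `χ₀ + χ₁ = 1_{K_H}` on the stable orbit ⇒ same stable orbital integral as the unit
  have horbit : stableOrbitalIntegralRel (IsLocalStablyConjH L v) mH ((((((cmLocalIntegralLevel L 2 (Matrix.of fun i j : Fin 2 => if i.val + j.val + 1 = 2 then (1 : L) else 0) v).prod (cmLocalIntegralLevel L 1 (Matrix.of fun i j : Fin 1 => if i.val + j.val + 1 = 1 then (1 : L) else 0) v)) : Subgroup ((cmDatum L 2 (Matrix.of fun i j : Fin 2 => if i.val + j.val + 1 = 2 then (1 : L) else 0)).Local v × (cmDatum L 1 (Matrix.of fun i j : Fin 1 => if i.val + j.val + 1 = 1 then (1 : L) else 0)).Local v)) : Set ((cmDatum L 2 (Matrix.of fun i j : Fin 2 => if i.val + j.val + 1 = 2 then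 (1 : L) else 0)).Local v × (cmDatum L 1 (Matrix.of fun i j : Fin 1 => if i.val + j.val + 1 = 1 then (1 : L) else 0)).Local v)).indicator fun h => if (redMat (((h).1.val : GL (Fin 2) (UnitaryGroup.LocalRing L v)).val.map (Pi.evalRingHom (fun w' : PlacesOver L v => w'.1.adicCompletion L) w)) - 1) ^ 2 = 0 ∧ (redMat (((h).1.val : GL (Fin 2) (UnitaryGroup.LocalRing L v)).val.map (Pi.evalRingHom (fun w' : PlacesOver L v => w'.1.adicCompletion L) w)) - 1).rank = 0 then (1 : ℂ) else 0) + (((((cmLocalIntegralLevel L 2 (Matrix.of fun i j : Fin 2 => if i.val + j.val + 1 = 2 then (1 : L) else 0) v).prod (cmLocalIntegralLevel L 1 (Matrix.of fun i j : Fin 1 => if i.val + j.val + 1 = 1 then (1 : L) else 0) v)) : Subgroup ((cmDatum L 2 (Matrix.of fun i j : Fin 2 => if i.val + j.val + 1 = 2 then (1 : L) else 0)).Local v × (cmDatum L 1 (Matrix.of fun i j : Fin 1 => if i.val + j.val + 1 = 1 then (1 : L) else 0)).Local v)) : Set ((cmDatum L 2 (Matrix.of fun i j : Fin 2 => if i.val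 + j.val + 1 = 2 then (1 : L) else 0)).Local v × (cmDatum L 1 (Matrix.of fun i j : Fin 1 => if i.val + j.val + 1 = 1 then (1 : L) else 0)).Local v)).indicator fun h => if (redMat (((h).1.val : GL (Fin 2) (UnitaryGroup.LocalRing L v)).val.map (Pi.evalRingHom (fun w' : PlacesOver L v => w'.1.adicCompletion L) w)) - 1) ^ 2 = 0 ∧ (redMat (((h).1.val : GL (Fin 2) (UnitaryGroup.LocalRing L v)).val.map (Pi.evalRingHom (fun w' : PlacesOver L v => w'.1.adicCompletion L) w)) - 1).rank = 1 then (1 : ℂ) else 0)) γH =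
      stableOrbitalIntegralRel (IsLocalStablyConjH L v) mH (((((cmLocalIntegralLevel L 2 (Matrix.of fun i j : Fin 2 => if i.val + j.val + 1 = 2 then (1 : L) else 0) v).prod (cmLocalIntegralLevel L 1 (Matrix.of fun i j : Fin 1 => if i.val + j.val + 1 = 1 then (1 : L) else 0) v)) : Subgroup ((cmDatum L 2 (Matrix.of fun i j : Fin 2 => if i.val + j.val + 1 = 2 then (1 : L) else 0)).Local v × (cmDatum L 1 (Matrix.of fun i j : Fin 1 => if i.val + j.val + 1 = 1 then (1 : L) else 0)).Local v)) : Set ((cmDatum L 2 (Matrix.of fun i j : Fin 2 => if i.val + j.val + 1 = 2 then (1 : L) else 0)).Local v × (cmDatum L 1 (Matrix.of fun i j : Fin 1 => if i.val + j.val + 1 = 1 then (1 : L) else 0)).Local v)).indicator fun _ => (1 : ℂ)) γH :=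
    stableOrbitalIntegralRel_congr_fun_of_eqOn mH {h : ((cmDatum L 2 (Matrix.of fun i j : Fin 2 => if i.val + j.val + 1 = 2 then (1 : L) else 0)).Local v × (cmDatum L 1 (Matrix.of fun i j : Fin 1 => if i.val + j.val + 1 = 1 then (1 : L) else 0)).Local v) | h ∈ (((cmLocalIntegralLevel L 2 (Matrix.of fun i j : Fin 2 => if i.val + j.val + 1 = 2 then (1 : L) else 0) v).prod (cmLocalIntegralLevel L 1 (Matrix.of fun i j : Fin 1 => if i.val + j.val + 1 = 1 then (1 : L) else 0) v)) : Subgroup ((cmDatum L 2 (Matrix.of fun i j : Fin 2 => if i.val + j.val + 1 = 2 then (1 : L) else 0)).Local v × (cmDatum L 1 (Matrix.of fun i j : Fin 1 => if i.val + j.val + 1 = 1 then (1 : L) else 0)).Local v)) → (redMat (((h).1.val : GL (Fin 2) (UnitaryGroup.LocalRing L v)).val.map (Pi.evalRingHom (fun w' : PlacesOver L v => w'.1.adicCompletion L) w)) - 1) ^ 2 = 0}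
      (fun b hb y => fun hy => sq_redMat_sub_one_eq_zero_of_isLocalStablyConjH L v w hw hreg α γ hα hγ hαγ hα1 hγ1 hb y hy)
      (fun h hh => (Pi.add_apply _ _ h).trans (indicator_ite_redMat_zero_add_one L v w χdec₀ χdec₁ hh))
  -- additivity and the two known values
  have hadd := localStableOrbitalIntegralH_add_of_isLocSmooth L v hmH.isAdmissibleOn γH hreg _ _ h0 h1
  have hunit := stableOrbitalIntegralRel_indicator_eq_mul_phiH_of_isRoot L v w hw νH hv hmH hreg hell α γ hα hγ hαγ N hN
  have hzero := stableOrbitalIntegralRel_chiZero_eq_mul_phiH_of_isRoot L v w hw νH hv hmH hreg hell α γ hα hγ hαγ N hN hα1 hγ1 χdec₀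
  have hone : stableOrbitalIntegralRel (IsLocalStablyConjH L v) mH (((((cmLocalIntegralLevel L 2 (Matrix.of fun i j : Fin 2 => if i.val + j.val + 1 = 2 then (1 : L) else 0) v).prod (cmLocalIntegralLevel L 1 (Matrix.of fun i j : Fin 1 => if i.val + j.val + 1 = 1 then (1 : L) else 0) v)) : Subgroup ((cmDatum L 2 (Matrix.of fun i j : Fin 2 => if i.val + j.val + 1 = 2 then (1 : L) else 0)).Local v × (cmDatum L 1 (Matrix.of fun i j : Fin 1 => if i.val + j.val + 1 = 1 then (1 : L) else 0)).Local v)) : Set ((cmDatum L 2 (Matrix.of fun i j : Fin 2 => if i.val + j.val + 1 = 2 then (1 : L) else 0)).Local v × (cmDatum L 1 (Matrix.of fun i j : Fin 1 => if i.val + j.val + 1 = 1 then (1 : L) else 0)).Local v)).indicator fun h => if (redMat (((h).1.val : GL (Fin 2) (UnitaryGroup.LocalRing L v)).val.map (Pi.evalRingHom (fun w' : PlacesOver L v => w'.1.adicCompletion L) w)) - 1) ^ 2 = 0 ∧ (redMat (((h).1.val : GL (Fin 2) (UnitaryGroup.LocalRing L v)).val.map (Pi.evalRingHom (fun w' : PlacesOver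 L v => w'.1.adicCompletion L) w)) - 1).rank = 1 then (1 : ℂ) else 0) γH =
      stableOrbitalIntegralRel (IsLocalStablyConjH L v) mH ((((((cmLocalIntegralLevel L 2 (Matrix.of fun i j : Fin 2 => if i.val + j.val + 1 = 2 then (1 : L) else 0) v).prod (cmLocalIntegralLevel L 1 (Matrix.of fun i j : Fin 1 => if i.val + j.val + 1 = 1 then (1 : L) else 0) v)) : Subgroup ((cmDatum L 2 (Matrix.of fun i j : Fin 2 => if i.val + j.val + 1 = 2 then (1 : L) else 0)).Local v × (cmDatum L 1 (Matrix.of fun i j : Fin 1 => if i.val + j.val + 1 = 1 then (1 : L) else 0)).Local v)) : Set ((cmDatum L 2 (Matrix.of fun i j : Fin 2 => if i.val + j.val + 1 = 2 then (1 : L) else 0)).Local v × (cmDatum L 1 (Matrix.of fun i j : Fin 1 => if i.val + j.val + 1 = 1 then (1 : L) else 0)).Local v)).indicator fun h => if (redMat (((h).1.val : GL (Fin 2) (UnitaryGroup.LocalRing L v)).val.map (Pi.evalRingHom (fun w' : PlacesOver L v => w'.1.adicCompletion L) w)) - 1) ^ 2 = 0 ∧ (redMat (((h).1.val : GL (Fin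 2) (UnitaryGroup.LocalRing L v)).val.map (Pi.evalRingHom (fun w' : PlacesOver L v => w'.1.adicCompletion L) w)) - 1).rank = 0 then (1 : ℂ) else 0) + (((((cmLocalIntegralLevel L 2 (Matrix.of fun i j : Fin 2 => if i.val + j.val + 1 = 2 then (1 : L) else 0) v).prod (cmLocalIntegralLevel L 1 (Matrix.of fun i j : Fin 1 => if i.val + j.val + 1 = 1 then (1 : L) else 0) v)) : Subgroup ((cmDatum L 2 (Matrix.of fun i j : Fin 2 => if i.val + j.val + 1 = 2 then (1 : L) else 0)).Local v × (cmDatum L 1 (Matrix.of fun i j : Fin 1 => if i.val + j.val + 1 = 1 then (1 : L) else 0)).Local v)) : Set ((cmDatum L 2 (Matrix.of fun i j : Fin 2 => if i.val + j.val + 1 = 2 then (1 : L) else 0)).Local v × (cmDatum L 1 (Matrix.of fun i j : Fin 1 => if i.val + j.val + 1 = 1 then (1 : L) else 0)).Local v)).indicator fun h => if (redMat (((h).1.val : GL (Fin 2) (UnitaryGroup.LocalRing L v)).val.map (Pi.evalRingHom (fun w' : PlacesOver L v => w'.1.adicCompletion L) w)) - 1) ^ 2 = 0 ∧ (redMat (((h).1.val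 : GL (Fin 2) (UnitaryGroup.LocalRing L v)).val.map (Pi.evalRingHom (fun w' : PlacesOver L v => w'.1.adicCompletion L) w)) - 1).rank = 1 then (1 : ℂ) else 0)) γH - stableOrbitalIntegralRel (IsLocalStablyConjH L v) mH (((((cmLocalIntegralLevel L 2 (Matrix.of fun i j : Fin 2 => if i.val + j.val + 1 = 2 then (1 : L) else 0) v).prod (cmLocalIntegralLevel L 1 (Matrix.of fun i j : Fin 1 => if i.val + j.val + 1 = 1 then (1 : L) else 0) v)) : Subgroup ((cmDatum L 2 (Matrix.of fun i j : Fin 2 => if i.val + j.val + 1 = 2 then (1 : L) else 0)).Local v × (cmDatum L 1 (Matrix.of fun i j : Fin 1 => if i.val + j.val + 1 = 1 then (1 : L) else 0)).Local v)) : Set ((cmDatum L 2 (Matrix.of fun i j : Fin 2 => if i.val + j.val + 1 = 2 then (1 : L) else 0)).Local v × (cmDatum L 1 (Matrix.of fun i j : Fin 1 => if i.val + j.val + 1 = 1 then (1 : L) else 0)).Local v)).indicator fun h => if (redMat (((h).1.val : GL (Fin 2) (UnitaryGroup.LocalRing L v)).val.map (Pi.evalRingHom (fun w' : PlacesOver L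 v => w'.1.adicCompletion L) w)) - 1) ^ 2 = 0 ∧ (redMat (((h).1.val : GL (Fin 2) (UnitaryGroup.LocalRing L v)).val.map (Pi.evalRingHom (fun w' : PlacesOver L v => w'.1.adicCompletion L) w)) - 1).rank = 0 then (1 : ℂ) else 0) γH := by
    rw [hadd]; ring
  rw [hone, horbit, hunit, hzero]
  push_cast
  ring

end Heads

end Literature.NumberTheory.Automorphic.UnitaryGroup

end
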